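import Literature.MathematicalPhysics.QuantumFieldTheory.Balaban1983to89.B14From190LayerSizes
import Literature.MathematicalPhysics.QuantumFieldTheory.Balaban1983to89.B15Ineq131From190
import Literature.MathematicalPhysics.QuantumFieldTheory.Balaban1983to89.B15Ineq139From190
import Literature.MathematicalPhysics.QuantumFieldTheory.Balaban1983to89.B15Ineq142From190
import Literature.MathematicalPhysics.QuantumFieldTheory.Balaban1983to89.B15Ineq148From190
import Literature.MathematicalPhysics.QuantumFieldTheory.Balaban1983to89.B15Ineq154From190
import Literature.MathematicalPhysics.QuantumFieldTheory.Balaban1983to89.B15Ineq191From190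
import Literature.MathematicalPhysics.QuantumFieldTheory.Balaban1983to89.B11MeanValue190
import Literature.MathematicalPhysics.QuantumFieldTheory.Balaban1983to89.B15Bounds199

/-!
# `Balaban1983to89.B15From190LayerSizes` — T. Bałaban, *Large field renormalization. I. The basic step of the 𝐑
# operation*, Commun. Math. Phys. **122** (1989) 175–202 [Balaban1989LargeFieldI] = [IV], §1: the (190)-knittings of
# (1.31), (1.37)–(1.39), (1.42), (1.90)–(1.91) with BOTH sides of the block-size ↔ lattice-value DICTIONARY discharged BY
# NAME — the INPUT B-sizes `hm…` of the argument fields from p29's lattice theorems at the sup size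
# (`B15LayerSupSize`, `B15LayerLocal`, `B14ArgField36Lattice`), their localisation distances `hD…` reduced to box
# geometry, and the OUTPUT dictionary `hdom…` from r11's sizes `B11SupSize190.supSize` /
# `B11SeminormSize190.covDerivBlockSize` (set membership)

statement-level skeleton of published theorems with citation tags; proofs where landed; nothing here is a claim
about the Yang–Mills mass gap

CITATION HEADER (lean-in-tree rule 2026-08-18).  T. Bałaban, *Large field renormalization. I. The basic step of the 𝐑
operation*, Commun. Math. Phys. **122**, 175–202 (1989), doi:10.1007/BF01257412, bib `Balaban1989LargeFieldI` (cell
paper B15 = "[IV]"; PDF held `paper:balaban1989-cmp122-large-field-i`, journal page = PDF page + 174; pp. 183–185, 198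
= PDF 9–11, 24, OCR `p0009.txt`–`p0011.txt`, `p0024.txt` re-read by this seat for this file).  "[15]" = T. Bałaban,
CMP **102** (1985) 277–309 [Balaban1985Variational], (190) p. 308 (tree: `B11SectG.Ineq190`; its sizes *"for x ∈ Δ(y)"* =
`B11SupSize190.supSize`, first-order size = `B11SeminormSize190.covDerivBlockSize`); "[3]" = [Balaban1984PropagatorsII]
(2.61) p. 234 (`B11SectG.RowSum`); "[III]" = [Balaban1988Convergent] (2.5) (`B14.IsRj`).

WHAT IS REPRODUCED.  SKELETON rows **B15.Eq1.31** (with B15.Eq1.3–1.4, B15.Eq1.30), **B15.Eq1.37–1.39** (with B15.Eq1.38,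
B15.Eq1.34–1.36), **B15.Eq1.42** (with B15.Eq1.40–1.41), **B15.Eq1.91** (with B15.Eq1.90) of the mega-formalization
`lit-balaban` (HOME `run/shared/lean/pub/lit-balaban/`, unit `lit-balaban-r12` gen 9 = reader/typer and fold owner of block
B15; cell GAPS.md G-B15-r12-08 addendum 3).  The printed sentences (verbatim): p. 183–184 *"The field in the argument of
the function ℍ_{j,□} is equal to 0 on almost the whole cube □^{∼4}, except a boundary layer of the width 2M₁ in the lattice
T_ξ, ξ = L^{−j}. On this boundary the field can be bounded by 22d²ε_j … The exponential decay property of ℍ_{j,□} implies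
that on the cube □^∼ this function and its covariant derivatives can be bounded by B₃exp(−δ2M₂R_j)22d²ε_j < (β/10)ε_j.
Estimating … as in (3.8) [III] we obtain |U_{j,□}(∂p) − 1| < … < ε_j(L^{k−j}η)² for p ⊂ □^∼ (1.31)"*;  p. 185 *"Consider
now the field in the argument of the function ℍ. On the domain Ω_{j+1}∩Z_{j+1}, except a boundary layer of the width 2LM₁
at the boundary ∂Z_{j+1}, this field is equal to 0. On the boundary layer it can be bounded by 22d²ε_{j+1}. Similarly, on
the domain Ω^c_j∩Z^c_j [sic; p. 184 (the sentence before (1.34)) has Ω^c_{j+1}∩Z^c_j], except a boundary layer of the width 2M₁ at the boundary ∂Z^c_j, the field is equal to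
(1/i)log[V_j(V_Z^{(j)})⁻¹], hence it can be bounded by 4δ′_j, as it follows from the restrictions in (1.27). On the boundary
layer it can be bounded by 22d²ε_j. From this, and the exponential decay property, it follows that [(1.38)] … We assume
that it is so small that the expression on the left-hand side of (1.37) can be bounded by ½δ_j"*;  p. 185 *"The function
ℍ_{j+1,□′} is bounded on □′^{∼2} by B₃exp(−δLM₂R_{j+1})22d²ε_{j+1}, hence [(1.42)] ≦ ½δ_j"*;  p. 198 *"The function ℍ_{h,□}
and it[s] derivatives can be bounded on □^∼ by B₃exp(−δ2LM₂R_h)11d²ε_h < 11d²B₃exp(−R_h)ε_h < αε_h … Estimating as in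
(1.46) we get [(1.91)]"*.  (v1.4, r12 gen 19, `lit-balaban-r12/QUOTE-AUDIT-B15.md` findings A5/A10/L3/L4: DOCSTRING ONLY — four passages of
§§6–9 that v1–v1.3 carried inside quotation marks were paraphrases, not the printed words (p. 188 «the field −(1/i)log[…] is localized in the
layer of the thickness 2M₁ at the boundary ∂Z, and it can be estimated there by …», p. 199 «The fields in the exponential transformations
(1.92), (1.93) … the restriction introduced by χ_{h,1/2} yield …», «can be obtained by expanding the configuration (1.97) in B′», «the
field is equal to 0 outside Σ»); restored verbatim from the page images PDF 14/25; one [sic] made explicit in the p. 185 quotation above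
(print's Ω^c_j∩Z^c_j, which v1 had silently aligned with p. 184's Ω^c_{j+1}∩Z^c_j); no declaration, statement or proof changed.)

THE KNITTING (used BY NAME, nothing restated).  r12 gen 8 derived each of these from [15] (190) for ABSTRACT sizes:
`B15Ineq131From190.ineq131_lt_lattice_of_ineq190_gamma`, `B15Ineq139From190.ineq139_half_lattice_of_ineq190_gamma'`,
`B15Ineq142From190.ineq142_le_half_lattice_of_ineq190_gamma'`, `B15Ineq191From190.ineq191_lattice_twoSup_of_ineq190_gamma`,
with three kinds of dictionary hypotheses: the INPUT B-size `hm : ∀ y′, bB.loc y′ B ≤ m` and localisation `hD : bB.loc y′ B ≠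
0 → D ≤ dist y y′` of an abstract argument vector `B : FB`, and the OUTPUT domination `hdom : ‖ℍ(x)‖ ≤ bout.loc y ℍB` of the
lattice values by an abstract size.  p29 gen 7 proved the printed input sizes on the `ℤ^d` carriers and AT THE SUP SIZE
(`B15LayerSupSize.loc_layer130_le` — 22d²ε_j —, `loc_layer190_le` — 11d²ε_h —, `loc_top_le`/`B14ArgField36Lattice.argField145_lt`
— 4δ′_j —, `loc_layer138_Zc_le`/`layer138_Zc_le_local` — 22d²ε_j on `Z^c_j` —, `B15LayerLocal.layer130_lt_local`), r11 gen 7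
typed [15]'s sizes (`B11SupSize190.supSize`, dictionary lemma `norm_apply_apply_le_loc`; `B11SeminormSize190.covDerivBlockSize`,
dictionary lemma `norm_covDerivFwd_le_loc`) and composed the B14 knits (`B14From190LayerSizes`, p269225).  THIS FILE is the B15
twin of `B14From190LayerSizes`: `FB := X → 𝔸` on an index set `X` of bonds of p29's cube tower(s) (`dep`, `pt`, `dir`),
`bB := supSize gB boxB blkB`, `B :=` p29's concrete argument field, `bout := supSize gB box blk` (and `covDerivBlockSize gB y₀ S ξ
U₀` for the covariant-derivative sizes), `ℍB := ℍ` itself, the fine field `U₀` SHARED between the argument field and the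
consumer.

WHAT THIS FILE PROVES (kernel-checked, zero `sorry`; no `def`, no new `Prop`, no new named fact; axioms standard).
* (private) `exists_ne_zero_of_loc_ne_zero` — a nonzero sup size exhibits a nonzero value in the box (turns every `hD` into
  box geometry `hfar`; same bookkeeping as in `B14From190LayerSizes`, private there).
* `ineq131_lt_of_ineq190_layer` — **(1.31)** `|U_{j,□}(∂p) − 1| < ε_jξ²` on the lattice model from (190) and γ, with `hm`
  DISCHARGED by `loc_layer130_le` for the (1.30) field `B i = log[M^{j−dep i}(U₀)(b_i)((Q^{s*}_{dep i}M^j(U₀))(b_i))⁻¹]` (print's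
  `−(1/i)log[M˙(U_k^{(n)})(M˙(Q_j^{s*}V_j))⁻¹]` up to the overall sign and the factor `1/i`, immaterial for sizes and supports),
  `hD` ↦ `hfar`, the six output dictionary hypotheses ↦ membership of `x, x + e_μ, x + e_ν` in `box y` and of `(x,μ,ν)`, `(x,ν,μ)`
  in `S y`; and `ineq131_lt_of_ineq190_layer_scale` — the same at print's `ξ = L^{−j}`, where the consumer's plaquette input
  `|U₀(∂p) − 1| < (1 − β½)ε_jξ²` is the SAME (1.24) hypothesis `h124` that sizes the argument field (`le_pdevOn`).
* `ineq142_le_half_of_ineq190_layer` — **(1.42)** `≦ ½δ_j` likewise: `hm` by `loc_layer130_le` one scale up (the argument field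
  of `ℍ_{j+1,□′}`, size `22d²ε_{j+1}`), `hD` ↦ `hfar`, `hdom` ↦ `hbox` (the box of `y` contains the sites of `B^j(b₋) ∪ B^j(b₊)`).
* `ineq139_half_of_ineq190_layer` — **(1.37)–(1.39)**, lhs of (1.37) `≤ ½δ_j`, likewise with print's THREE pieces of the (1.34)
  argument field realised on one index set `X` split by a region tag `rg : X → Bool` (`true` = the `Ω_{j+1}∩Z_{j+1}` tower of
  `j+1` levels: *"equal to 0 … bounded by 22d²ε_{j+1}"*, `layer130_lt_local`, far `≥ MR_{j+1}`) and by depth on the `Ω^c_{j+1}∩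
  Z^c_j` tower of `j` levels (`dep i = 0`: *"equal to (1/i)log[V_j(V_Z^{(j)})⁻¹], hence … 4δ′_j"*, `argField145_lt` from (1.27);
  `dep i ≠ 0`: *"On the boundary layer … 22d²ε_j"*, `layer138_Zc_le_local`, far `≥ 6LMR_{j+1}`).
* `ineq191_twoSup_of_ineq190_layer` — **(1.90) ⇒ (1.91)** (two-sup reading) likewise: `hm` by `loc_layer190_le` (11d²ε_h),
  `hD` ↦ `hfar`, the six output dictionary hypotheses ↦ membership.
HONEST SCOPE.  (1) What is discharged is the DICTIONARY (both sides) and the localisation-as-geometry; the hypotheses LEFT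
are exactly: [15] (190) itself for the user's derivative functionals `dH t` between the now CONCRETE sizes (`Ineq190 (supSize
gB boxB blkB) (supSize gB box blk) (dH t) C δ₀`, resp. `covDerivBlockSize`) — i.e. [15] Prop. 9, a typed statement of block
B11, not proved in the tree —, (2.61) `RowSum`, the mean-value reading `hmv` (how Prop. 9's derivative bound controls `ℍ(B)`,
`ℍ(0) = 0`), the box/tower GEOMETRY (`hbox`/`hx…`/`hS…`, `hfar…`, `hX…`, `hgeom`), p29's lattice models with their located
side conditions and the explicit γ-clauses of gen 8, all in the printed shapes.  (2) p29's HONEST SCOPE carries over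
verbatim (regularity on the finest cube of the tower only, block-axial gauge `h15` on the tower, `AvgClosed` value group,
print's strict `<` sizes used as `≤`); the number of tower levels and the consumer's scale are identified where print
identifies them (`U₀` shared; `ξ = L^{−j}` in the `_scale` form).  (3) Nothing here is new mathematics: every theorem is a
composition of landed theorems.  NOT summit progress.  r12 gen 9 (literature-prover-lit-balaban-r12-g9-0).

VERSIONS.  v1 = p297978 (commit e5bacd9e6921; §§0–4).  v1.1 (this file) is APPEND-ONLY: two imports added
(`B15Ineq148From190`, `B15Ineq154From190`), no v1 declaration, statement or proof changed, and two sections added for the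
knits whose sizes carry print's EXPLICIT WEIGHTS — (1.45) *"sup_{B^i(y)} L^iη|ℍ^{(n)}_{k,Z}|, sup_{B^i(y)} (L^iη)²|∇^η ℍ^{(n)}_{k,Z}|"*
and (1.57) *"|ℍ^{(n+1)}_{k,Z}| ≤ (L^{j+1}η)^{−1}B₃exp(…)44d²B₃ε_k"* —, realised faithfully as the plain sup size `supSize` of the
RESCALED function `w • ℍ` (`w = L^iη`, resp. `w = L^{j+1}η = (L^{k−j−1})⁻¹`) and, for the derivative, r11's `ofSeminorms` of the
scaled first-order seminorm `w.toNNReal • covDerivSize (S y) η U₀` (so that its value at `w • ℍ` is `w²·max‖∇^η_{U₀}ℍ‖`);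
SKELETON rows served in addition: **B15.Eq1.46**, **B15.Eq1.48** (with B15.Eq1.44, 1.45, 1.47), **B15.Eq1.54** (with B15.Eq1.56–1.58):
* §5 `ineq148_of_ineq190_layer` — **(1.46) ⇒ (1.48)** (`B15Ineq148From190.ineq148_lattice_of_ineq190_gamma'`) with `hm` (*"bounded
  by 4δ′_j"*) DISCHARGED by `B15LayerSupSize.loc_top_le` for the (1.44) field `(1/i)log[V_j(b)(V_Z^{(j)}(b))⁻¹]` on the top bonds of
  `Ω^c_{j+1}∖Z″_{j+1}` from (1.27), `hD` ↦ `hfar` (*"localized in the domain Ω^c_{j+1}∖Z″_{j+1}"*), the six weighted output dictionary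
  hypotheses ↦ membership (private `weighted_sup_dict`, `weighted_cov_dict`); the (1.47) distance input `hgeo` stays as printed.
* §6 `second154_lt_of_ineq190_layer` — **(1.57)–(1.58) ⇒ the second expression of (1.54) «much smaller than δ′_j»**
  (`B15Ineq154From190.second154_lt_lattice_of_ineq190_gamma'`) with `hm` (*"bounded by 44d²B₃ε_k"*) DISCHARGED by
  `B15LayerSupSize.loc_layer156_le` for the (1.56) field of the fine field `U = U_k^{(n+1)}` (`k` levels; NOT identified with the
  consumer's background `U₀ = U^{(n+1)}_{k,Z}` — they are different configurations in print), `hD` ↦ `hfar` (the ten-layers geometry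
  `δ10MΣR + δMR_k ≤ τD` stays the printed hypothesis `hgeom`), `hdom` ↦ `hbox` at the weight `L^{k−j−1}` (private `inv_weighted_sup_dict`).

v1.2 (r12 gen 10, literature-prover-lit-balaban-r12-g10-0) is APPEND-ONLY: one import added (`B11MeanValue190`, p29 gen 8, p301458),
no v1/v1.1 declaration, statement or proof changed, three sections added; SKELETON rows served in addition: **B15.Eq1.96** (with
B15.Eq1.90–1.95), and the `hmv` clause of GAPS G-B15-r12-08 (Addendum 3) in kernel form.
* §7 `ineq191_twoSup_of_ineq190_layerW` — **(1.90) ⇒ (1.91)** as §4 but with the fine field of the (1.90) argument-field tower a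
  SEPARATE lattice field `W` (print: the tower of the REPRESENTED field `U″_{k,Z}`, `B = (1/i)log[M˙(U″_{k,Z})(M˙(Q_h^{s*}V″))⁻¹]`,
  `V″ =` the top constraint of `U″_{k,Z}`), NOT identified with the consumer's background `U₀` (print: `U_{h,□}(V″)`, the `dev₀` of
  `Ineq191`) nor with its represented field; §4 is the special case `W = U₀`.  ERRATUM to the v1 docstring of §4: its parenthesis
  *«fine field `U₀ = U″_{k,Z}`»* mis-names the role of `U₀` there — `U₀` is the background of the representation AND the fine field of the
  tower in that theorem; in print these are two objects (`U_{h,□}(V″)` and `U″_{k,Z}`).  READING NOTE (GAPS G-B15-r12-09, nothing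
  refuted): p29's located reading of the printed size *"11d²ε_h"* (`B15Layer130Lattice.layer190_lt`: *«U″_{k,Z} enters through a
  plaquette bound |U″_{k,Z}(∂p) − 1| < ½ε_h(L^{k−h}η)², the scale of the restrictions χ_{h,1/2}»*) makes the a-priori input `h190p` of
  the (1.90) chain a plaquette bound on the field whose plaquette bound (1.96) *«< ¾ε_h(L^{k−h}η)²»* is the OUTPUT of p. 199; print
  does not locate the source of the `11d²ε_h` (χ_{h,1/2} of (1.88) restricts `U_{h,□}((1,V_h))`, not `U″_{k,Z}`), so every knit keeps
  `W` free and `h190p` explicit — an implication, no circularity asserted or hidden.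
* §8 `ineq196_twoSup_of_ineq190_layer` — **(1.96) «|U″_{k,Z}(∂p) − 1| < ¾ε_h(L^{k−h}η)² < (1 − β(1 − 2^{−(k−h+1)}))ε_h(L^{k−h}η)²»**
  on the lattice (`B15Ineq191Lattice.ineq196_lattice_twoSup`, two-sup reading: print's `α = 1/12` for the one-sup leaves is `2·(1/24)`)
  with chain 1 (= (1.90)/(1.91): `ℍ₁ = ℍ_{h,□}` of the representation of `U″_{k,Z}` over `U_{h,□}(V″) =: Uhb`) DERIVED from [15]
  (190) + γ with ALL SIZES CONCRETE as in §7 (`hm` by `loc_layer190_le` on the tower of `W`, `hD` ↦ `hfar`, the six output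
  dictionary hypotheses ↦ membership at `supSize`/`covDerivBlockSize gB y₀ S ξ Uhb`; γ-clause `11d²B₃γ² < 1/24`), and chain 2 (=
  (1.93)–(1.95): `ℍ₂ = ℍ_{h,□}` of the representation of `U_{h,□}(V″)` over `U_{h,□}((1,V_h)) =: U₁`) entering EXACTLY through the
  printed bound (1.94) *"< αε_h"* (`hB…`, `hBD…`, `hY₂ : Y₂ < (1/24)ε_h`; row B15.Eq1.94 is proved separately along the flow,
  `B15Ineq194Last.ineq194_chain_along_flow`) — the gen-8 knit `B15Ineq191From190.ineq196_lattice_of_ineq190_gamma` had fed chain 2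
  a (1.90)-type size `11d²ε_h` instead; the `χ_{h,1/2}`-restriction `hhalf`, `β ≤ ¼`, `0 < ε_h ≤ 1/10`, `t = 2^{−(k−h+1)} ∈ (0,1]`,
  `0 ≤ L^{−h} ≤ 1` as located in `ineq196_lattice`.
* §9 `ineq196_twoSup_of_ineq190_layer_mv` — §8 with the mean-value domination `hmv₀`/`hmv₁` DISCHARGED by p29's
  `B11MeanValue190.hmv_supSize_of_forall` / `hmv_covDerivBlockSize` (index family `T := Icc 0 1`): the `ℍ`-operator is a map
  `Hop : (X → 𝔸) → (T^{(k)} → 𝔸^d)` with `Hop 0 = 0` ([15] (175)) whose values `τ ↦ Hop(τB)(z)` have the derivative `(dH τ B)(z)`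
  within `[0,1]` at every `τ ∈ [0,1]` ([15] Sect. G), `ℍ₁ := Hop B` for the concrete argument field `B` of the tower of `W`.  The same
  two-line discharge applies verbatim to the `hmv…` hypotheses of §§1–7 (not restated).

v1.3 (r12 gen 10) is APPEND-ONLY: one import added (`B15Bounds199`, r12 gen 7, p253777), no earlier declaration, statement or
proof changed, one section added; SKELETON rows served in addition: **B15.Eq1.98** (with B15.Eq1.97, 1.80).
* §10 `ineq198_twoSup_of_ineq190_layer199` — **(1.98) p. 200 ON THE LATTICE WITH THE TWO p. 199 `ℍ`-CHAINS AS PRINTED** (two-sup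
  reading, `B15Ineq191Lattice.ineq191_lattice_twoSup` ×2 + `B15Ineq196Proof.ineq198`): CHAIN 1 — `ℍ₁` of the representation of
  `U″_{k,Z}` over the configuration `C` of (1.97), p. 199 *"the field is … bounded by 22d²max{1, …}ε_h + 2δ′_k < 23d²ε_h … The
  ℍ-function … can be bounded by B₃exp(−δ(M/M₁)(j−h))exp(−½δMR_h)23d²ε_h ≦ 23d²B₃(1+β₀)²(1+(j−h)^{β₀})exp(−(j−h))exp(−R_h)ε_j <
  αε_j"* — FROM [15] (190) with ALL SIZES CONCRETE: input size `supSize` on the index set of p29's two-field tower of the layer `Σ`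
  (`B15LayerSupSize.loc_layer199_le`, 23d²ε_h, fine fields `U′` (print: `U″_{k,Z}`, plaquette input (1.96)) and `U₀′` (print:
  `U₀^{(AL)}`, plaquette input (1.80)) — free, not identified with the consumer's fields), `hD` ↦ `hfar`, r12's
  `B15HDecayLeaves.boundH199B_of_ineq190` + `B15Bounds199.chainB_le`/`chainB_lt` with the `R_h`-clause from γ
  (`B15GammaSmallness.exp_neg_R_le_gamma_sq`: `e^{−R_h} ≤ γ²`, clause `23d²B₃(1+β₀)²γ² < α′`), output sizes `supSize`/`covDerivBlockSize gB y₀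
  S ξ C` with the dictionary ↦ membership; CHAIN 2 — `ℍ₂` of the representation of `C` over `C₀ = U₀^{ū₀}` ((1.97) at `B′ = 0`), p. 199
  *"We expand the above function with respect to the variables B′. The corresponding ℍ-function can be bounded on the same domains as
  above by B₃δ′_k ≦ B₃(1+β₀)(1+(k−j)^{1/2})(A₁p₁(g_j))/(A₀p₀(g_j))ε_j < αε_j"* — FROM (190) with the input size `≤ δ′_k` from the pointwise restriction (1.82) `|B′(b)| < δ′_k` on a free field `B′`
  (`loc_le_of_forall`), `B15HDecayLeaves.boundH199C_of_ineq190` (global, no localisation) + `B15Bounds199.chainC_le`/`chainC_lt`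
  (letters `r_k ≤ r_j`, `(1 + s)`, clause `B₃(1+β₀)(1+s)r_j < α′` as printed), output sizes `supSize`/`covDerivBlockSize gB y₀ S ξ C₀`;
  then (1.80) `h180` for `C₀`, *"taking α ≤ 1/8"* as `2α′ ≤ 1/8`, the scale inequality and signs as located in `ineq198_lattice`.  The
  gen-8 knit `B15Ineq191From190.ineq198_lattice_of_ineq190_gamma` had fed BOTH chains (1.90)-shaped inputs `11d²ε_j`; this one uses
  the printed p. 199 sizes and decay exponents.
v1.4 (r12 gen 14, 2026-08-22): CITELOC DOCFIX ONLY — the locator «(175) p.306» of §11 now reads «(175) p.305» ([Balaban1985Variational] display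
(175) is the last display of p. 305 = PDF 29 l. 32; (177) opens p. 306; r08 gen-13 citeloc map, re-run by this seat over the non-B11 files and
re-read on the text layer); no declaration, statement or proof changed.
-/

noncomputable section

open scoped BigOperators
open NormedSpace Finset

namespace Literature.MathematicalPhysics.QuantumFieldTheory.Balaban1983to89.B15From190LayerSizes

open Literature.MathematicalPhysics.QuantumFieldTheory.Balaban1983to89
open MatrixLog B7Prop1Explicit B7Prop2Explicit B7Prop1Local B7Prop3Flat B7Eq92Concrete B7Eq162General B8Lemma1NonAbelian
  B8Ineq129 B8Ineq130 B8Ineq165Descent B15Ineq184BlockAxial B15Ineq184Local B8Eq115GaugeFixing B14ArgField36Lattice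
  B15LayerLocal B15LayerSupSize
open B11SectG B11SupSize190 B11SeminormSize190 B15Ineq131From190 B15Ineq139From190 B15Ineq142From190 B15Ineq191From190
open B15.Ineq194Flow
open B15Ineq148From190 B15Ineq154From190

variable {d : ℕ}

/-! ## §0 Bookkeeping: a nonzero sup size exhibits a nonzero value in the box -/

/-- If the sup size of `f` over `box y` is nonzero then some `f x`, `x ∈ box y`, is nonzero — so a localisation hypothesis
`loc y′ B ≠ 0 → D ≤ dist y y′` follows from the box geometry `x ∈ box y′ → D ≤ dist y y′`. [folklore] -/
private theorem exists_ne_zero_of_loc_ne_zero {g : B6.Geometry} {X E : Type} [NormedAddCommGroup E] [Module ℝ E]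
    {box : g.Site → Finset X} {blk : X → g.Site} {y : g.Site} {f : X → E}
    (h : (supSize g box blk : BlockNorm g (X → E)).loc y f ≠ 0) : ∃ x ∈ box y, f x ≠ 0 := by
  by_contra hc
  refine h (le_antisymm (loc_le_of_forall le_rfl fun x hx => ?_) ((supSize g box blk : BlockNorm g (X → E)).loc_nonneg y f))
  rw [Classical.not_not.1 (fun hx' => hc ⟨x, hx, hx'⟩), norm_zero]

/-! ## §1 (1.31): the (1.30) argument field (`22d²ε_j`, `loc_layer130_le`), sup and covariant-derivative output sizes -/

section Eq131

variable {gB : B6.Geometry} {X : Type}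
variable {𝔸 : Type} [CStarAlgebra 𝔸] [Nontrivial 𝔸]

/-- **(1.31) ⇒ "the functions (1.3) … are equal to 1", ON THE LATTICE MODEL, FROM [15] (190) AND γ, ALL SIZES CONCRETE** —
`B15Ineq131From190.ineq131_lt_lattice_of_ineq190_gamma` at the INPUT size `bB := supSize gB boxB blkB` on the bond index set `X`
of p29's (1.30) tower (`j` levels, fine field `U₀ = U_k^{(n)}`, `V_j = M^j(U₀)` by the constraints; `B i = log[M^{j−dep i}(U₀)(b_i)
((Q^{s*}_{dep i}M^j(U₀))(b_i))⁻¹]`), `hm` (*"can be bounded by 22d²ε_j"*) DISCHARGED by `B15LayerSupSize.loc_layer130_le` ((1.24)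
with `c = 1` on the finest cube only), `hD` REPLACED by `hfar` (*"equal to 0 on almost the whole cube □^{∼4}, except a boundary
layer"*: every block whose box carries a bond of the field is `≥ D` from `y`), `κ = 1`; and at the OUTPUT sizes `bout₀ :=
supSize gB box blk` (*"this function … on the cube □^∼"*), `bout₁ := covDerivBlockSize gB y₀ S ξ U₀` (*"and its covariant
derivatives"*), `ℍB := ℍ`: the six dictionary hypotheses REPLACED by the membership of the base points `x, x + e_μ, x + e_ν`
in `box y` and of the derivative points `(x,μ,ν)`, `(x,ν,μ)` in `S y`.  `U₀ ∈ {|u| ≤ 1}` from `AvgClosed.le_U1`.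
[cite: Balaban1989LargeFieldI, (1.30)–(1.31) pp.183–184; Balaban1985Variational, (190) p.308] -/
theorem ineq131_lt_of_ineq190_layer
    (boxB : gB.Site → Finset X) (blkB : X → gB.Site) (dep : X → ℕ) (pt : X → B7Prop1Explicit.Site d) (dir : X → Fin d)
    (box : gB.Site → Finset (B7Prop1Explicit.Site d)) (blk : B7Prop1Explicit.Site d → gB.Site)
    (y₀ : gB.Site) (S : gB.Site → Finset (B7Prop1Explicit.Site d × Fin d × Fin d))
    {T : Type*} {dH : T → (X → 𝔸) →ₗ[ℝ] (B7Prop1Explicit.Site d → Fin d → 𝔸)}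
    {C δ₀ σ τ c D B₃ δ M₂ εj β γ gj : ℝ} {r R : ℕ}
    {ξ : ℝ} {L : ℕ} {j : ℕ} {U₀ : B7Prop1Explicit.Site d → Fin d → 𝔸ˣ}
    (h190₀ : ∀ t, Ineq190 (supSize (X := X) (E := 𝔸) gB boxB blkB)
      (supSize (X := B7Prop1Explicit.Site d) (E := Fin d → 𝔸) gB box blk) (dH t) C δ₀)
    (h190₁ : ∀ t, Ineq190 (supSize (X := X) (E := 𝔸) gB boxB blkB) (covDerivBlockSize gB y₀ S ξ U₀) (dH t) C δ₀)
    (hC : 0 ≤ C) (hdist : ∀ a b : gB.Site, 0 ≤ gB.dist a b) (hrow : RowSum gB σ c) (hτ : 0 ≤ τ) (hστ : σ + τ ≤ δ₀ / 8)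
    (y : gB.Site)
    -- the (1.30) tower of p29 (`loc_layer130_le`): fine field `U₀`, `j` levels
    (hL : 2 ≤ L) (hd1 : 1 ≤ d) {G : Subgroup 𝔸ˣ} (hG : AvgClosed d L G) (hU₀ : ∀ x κ, U₀ x κ ∈ G)
    (hε : 0 < εj) (hε3 : C0 d * εj ≤ 1 / 3) (hε2 : 2 * εj ≤ c2' d L) (hεs : 11 * (d : ℝ) ^ 2 * εj ≤ 1 / 6)
    (lo hi : B7Prop1Explicit.Site d) (hlohi : lo ≤ hi)
    (h124 : pdevOn (tlo L lo j) (thi L hi j) U₀ < (1 - β * (1 / 2)) * εj * (((L : ℝ) ^ j)⁻¹) ^ 2)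
    (h15 : ∀ n, n < j → ∀ z, tlo L lo n ≤ z → z ≤ thi L hi n → ∀ r : Fin d → Fin L,
      axialFn (avgIter L U₀ (j - (n + 1))) ((L : ℤ) • z) ((L : ℤ) • z + boxVec L r) = 1)
    (hX : ∀ i, dep i ≤ j ∧ tlo L lo (dep i) ≤ pt i ∧ pt i + e (dir i) ≤ thi L hi (dep i))
    -- localisation, now geometry: the blocks carrying bonds of the field are `≥ D` away from `y`
    (hfar : ∀ y' i, i ∈ boxB y' → D ≤ gB.dist y y')
    -- the consumer side ((1.31) for the plaquette `p_{μν}(x)`)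
    (hξ : 0 < ξ) {H : B7Prop1Explicit.Site d → Fin d → 𝔸} (hH : ∀ z κ, IsSelfAdjoint (H z κ))
    {g : B7Prop1Explicit.Site d → 𝔸ˣ} (hg : ∀ z, g z ∈ U1 𝔸) (μ ν : Fin d) (x : B7Prop1Explicit.Site d)
    (hmv₀ : ∀ s : ℝ, (∀ t, (supSize (X := B7Prop1Explicit.Site d) (E := Fin d → 𝔸) gB box blk).loc y (dH t
        (fun i => mlog (((avgIter L U₀ (j - dep i) (pt i) (dir i) *
          (pullIter L (avgIter L U₀ j) (dep i) (pt i) (dir i))⁻¹ : 𝔸ˣ) : 𝔸)))) ≤ s) →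
      (supSize (X := B7Prop1Explicit.Site d) (E := Fin d → 𝔸) gB box blk).loc y H ≤ s)
    (hmv₁ : ∀ s : ℝ, (∀ t, (covDerivBlockSize gB y₀ S ξ U₀).loc y (dH t
        (fun i => mlog (((avgIter L U₀ (j - dep i) (pt i) (dir i) *
          (pullIter L (avgIter L U₀ j) (dep i) (pt i) (dir i))⁻¹ : 𝔸ˣ) : 𝔸)))) ≤ s) →
      (covDerivBlockSize gB y₀ S ξ U₀).loc y H ≤ s)
    (hgeom : δ * 2 * M₂ * R ≤ τ * D) (hCB : C * c ≤ B₃) (hB₃ : 0 ≤ B₃)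
    -- γ data
    (hr : 1 ≤ r) (hR : B14.IsRj L r gj R) (hgj : 0 < gj) (hgγ : gj ≤ γ) (hγe : 1 ≤ Real.log (γ ^ 2)⁻¹)
    (hc1 : 1 ≤ δ * 2 * M₂) (hγ : B₃ * (22 * (d : ℝ) ^ 2) * γ ^ 2 < β / 10)
    -- the output dictionaries, now set geometry
    (hx : x ∈ box y) (hxμ : x + e μ ∈ box y) (hxν : x + e ν ∈ box y)
    (hS₁ : (x, μ, ν) ∈ S y) (hS₂ : (x, ν, μ) ∈ S y)
    -- p29's located inputs of (1.31)
    (hβ0 : 0 < β) (hβ1 : β ≤ 1) (hε1 : εj ≤ 1) (hεξ : εj * ξ ≤ ((L : ℝ) ^ 2)⁻¹)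
    (hdev₀ : ‖B8Ineq132.plaqF U₀ μ ν x - 1‖ < (1 - β / 2) * εj * ξ ^ 2) :
    ‖B8Ineq132.plaqF (gaugeAct g (B8Lemma1NonAbelian.mulCfg (B8Eq146AExpansion.expCfg
        (B8Eq146AExpansion.iEta ξ H)) U₀)) μ ν x - 1‖ < εj * ξ ^ 2 := by
  have hL' : (2 : ℝ) ≤ (L : ℝ) := by exact_mod_cast hL
  exact ineq131_lt_lattice_of_ineq190_gamma h190₀ h190₁ hC hdist hrow hτ hστ _ y hξ (fun z κ => hG.le_U1 (hU₀ z κ)) hH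
    hg μ ν x
    (loc_layer130_le boxB blkB dep pt dir L hL hd1 hG j U₀ hU₀ hβ0.le hε hε3 hε2 hεs lo hi hlohi h124 h15 hX)
    (fun y' hne => by obtain ⟨i, hi, -⟩ := exists_ne_zero_of_loc_ne_zero hne; exact hfar y' i hi)
    hmv₀ hmv₁ hgeom (by rw [supSize_κ, mul_one]; exact hCB) hB₃ hr hR hgj hgγ hγe hc1 hε hγ
    (norm_apply_apply_le_loc hx H μ) (norm_apply_apply_le_loc hxμ H ν) (norm_apply_apply_le_loc hxν H μ)
    (norm_apply_apply_le_loc hx H ν) (norm_covDerivFwd_le_loc hS₁ H) (norm_covDerivFwd_le_loc hS₂ H)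
    hβ0 hβ1 hε1 hL' hεξ hdev₀

/-- **(1.31) AT PRINT'S SCALE `ξ = L^{−j}`** — `ineq131_lt_of_ineq190_layer` with `ξ := (L^j)⁻¹` (p. 183: *"in the lattice
T_ξ, ξ = L^{−j}"*; `ξ = L^{k−j}η`, `η = L^{−k}`): the consumer's `χ^{(n)}_k`-restriction `|U₀(∂p) − 1| < (1 − β½)ε_jξ²` at the
plaquette `p_{μν}(x)` is then the SAME (1.24) hypothesis `h124` that sizes the argument field, read on a plaquette of the
finest cube (`B7Prop1Local.le_pdevOn`). [cite: Balaban1989LargeFieldI, (1.24) p.181, (1.30)–(1.31) pp.183–184] -/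
theorem ineq131_lt_of_ineq190_layer_scale
    (boxB : gB.Site → Finset X) (blkB : X → gB.Site) (dep : X → ℕ) (pt : X → B7Prop1Explicit.Site d) (dir : X → Fin d)
    (box : gB.Site → Finset (B7Prop1Explicit.Site d)) (blk : B7Prop1Explicit.Site d → gB.Site)
    (y₀ : gB.Site) (S : gB.Site → Finset (B7Prop1Explicit.Site d × Fin d × Fin d))
    {T : Type*} {dH : T → (X → 𝔸) →ₗ[ℝ] (B7Prop1Explicit.Site d → Fin d → 𝔸)}
    {C δ₀ σ τ c D B₃ δ M₂ εj β γ gj : ℝ} {r R : ℕ}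
    {L : ℕ} {j : ℕ} {U₀ : B7Prop1Explicit.Site d → Fin d → 𝔸ˣ}
    (h190₀ : ∀ t, Ineq190 (supSize (X := X) (E := 𝔸) gB boxB blkB)
      (supSize (X := B7Prop1Explicit.Site d) (E := Fin d → 𝔸) gB box blk) (dH t) C δ₀)
    (h190₁ : ∀ t, Ineq190 (supSize (X := X) (E := 𝔸) gB boxB blkB)
      (covDerivBlockSize gB y₀ S (((L : ℝ) ^ j)⁻¹) U₀) (dH t) C δ₀)
    (hC : 0 ≤ C) (hdist : ∀ a b : gB.Site, 0 ≤ gB.dist a b) (hrow : RowSum gB σ c) (hτ : 0 ≤ τ) (hστ : σ + τ ≤ δ₀ / 8)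
    (y : gB.Site)
    (hL : 2 ≤ L) (hd1 : 1 ≤ d) {G : Subgroup 𝔸ˣ} (hG : AvgClosed d L G) (hU₀ : ∀ x κ, U₀ x κ ∈ G)
    (hε : 0 < εj) (hε3 : C0 d * εj ≤ 1 / 3) (hε2 : 2 * εj ≤ c2' d L) (hεs : 11 * (d : ℝ) ^ 2 * εj ≤ 1 / 6)
    (lo hi : B7Prop1Explicit.Site d) (hlohi : lo ≤ hi)
    (h124 : pdevOn (tlo L lo j) (thi L hi j) U₀ < (1 - β * (1 / 2)) * εj * (((L : ℝ) ^ j)⁻¹) ^ 2)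
    (h15 : ∀ n, n < j → ∀ z, tlo L lo n ≤ z → z ≤ thi L hi n → ∀ r : Fin d → Fin L,
      axialFn (avgIter L U₀ (j - (n + 1))) ((L : ℤ) • z) ((L : ℤ) • z + boxVec L r) = 1)
    (hX : ∀ i, dep i ≤ j ∧ tlo L lo (dep i) ≤ pt i ∧ pt i + e (dir i) ≤ thi L hi (dep i))
    (hfar : ∀ y' i, i ∈ boxB y' → D ≤ gB.dist y y')
    {H : B7Prop1Explicit.Site d → Fin d → 𝔸} (hH : ∀ z κ, IsSelfAdjoint (H z κ))
    {g : B7Prop1Explicit.Site d → 𝔸ˣ} (hg : ∀ z, g z ∈ U1 𝔸) (μ ν : Fin d) (x : B7Prop1Explicit.Site d)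
    (hmv₀ : ∀ s : ℝ, (∀ t, (supSize (X := B7Prop1Explicit.Site d) (E := Fin d → 𝔸) gB box blk).loc y (dH t
        (fun i => mlog (((avgIter L U₀ (j - dep i) (pt i) (dir i) *
          (pullIter L (avgIter L U₀ j) (dep i) (pt i) (dir i))⁻¹ : 𝔸ˣ) : 𝔸)))) ≤ s) →
      (supSize (X := B7Prop1Explicit.Site d) (E := Fin d → 𝔸) gB box blk).loc y H ≤ s)
    (hmv₁ : ∀ s : ℝ, (∀ t, (covDerivBlockSize gB y₀ S (((L : ℝ) ^ j)⁻¹) U₀).loc y (dH t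
        (fun i => mlog (((avgIter L U₀ (j - dep i) (pt i) (dir i) *
          (pullIter L (avgIter L U₀ j) (dep i) (pt i) (dir i))⁻¹ : 𝔸ˣ) : 𝔸)))) ≤ s) →
      (covDerivBlockSize gB y₀ S (((L : ℝ) ^ j)⁻¹) U₀).loc y H ≤ s)
    (hgeom : δ * 2 * M₂ * R ≤ τ * D) (hCB : C * c ≤ B₃) (hB₃ : 0 ≤ B₃)
    (hr : 1 ≤ r) (hR : B14.IsRj L r gj R) (hgj : 0 < gj) (hgγ : gj ≤ γ) (hγe : 1 ≤ Real.log (γ ^ 2)⁻¹)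
    (hc1 : 1 ≤ δ * 2 * M₂) (hγ : B₃ * (22 * (d : ℝ) ^ 2) * γ ^ 2 < β / 10)
    (hx : x ∈ box y) (hxμ : x + e μ ∈ box y) (hxν : x + e ν ∈ box y)
    (hS₁ : (x, μ, ν) ∈ S y) (hS₂ : (x, ν, μ) ∈ S y)
    (hβ0 : 0 < β) (hβ1 : β ≤ 1) (hε1 : εj ≤ 1) (hεξ : εj * ((L : ℝ) ^ j)⁻¹ ≤ ((L : ℝ) ^ 2)⁻¹)
    -- the plaquette `p_{μν}(x)` lies in the finest cube of the tower
    (hp : PlaqIn (tlo L lo j) (thi L hi j) (x, μ, ν)) :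
    ‖B8Ineq132.plaqF (gaugeAct g (B8Lemma1NonAbelian.mulCfg (B8Eq146AExpansion.expCfg
        (B8Eq146AExpansion.iEta (((L : ℝ) ^ j)⁻¹) H)) U₀)) μ ν x - 1‖ < εj * (((L : ℝ) ^ j)⁻¹) ^ 2 := by
  have hLpos : (0 : ℝ) < L := by exact_mod_cast (show 0 < L by omega)
  have hξ : (0 : ℝ) < ((L : ℝ) ^ j)⁻¹ := by positivity
  have h₀ : ∀ z κ, U₀ z κ ∈ U1 𝔸 := fun z κ => hG.le_U1 (hU₀ z κ)
  have hdev₀ : ‖B8Ineq132.plaqF U₀ μ ν x - 1‖ < (1 - β / 2) * εj * (((L : ℝ) ^ j)⁻¹) ^ 2 := by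
    have h := lt_of_le_of_lt (le_pdevOn h₀ hp) h124
    have e1 : (1 - β * (1 / 2)) * εj * (((L : ℝ) ^ j)⁻¹) ^ 2 = (1 - β / 2) * εj * (((L : ℝ) ^ j)⁻¹) ^ 2 := by ring
    rw [e1] at h
    exact h
  exact ineq131_lt_of_ineq190_layer boxB blkB dep pt dir box blk y₀ S h190₀ h190₁ hC hdist hrow hτ hστ y hL hd1 hG hU₀ hε
    hε3 hε2 hεs lo hi hlohi h124 h15 hX hfar hξ hH hg μ ν x hmv₀ hmv₁ hgeom hCB hB₃ hr hR hgj hgγ hγe hc1 hγ hx hxμ hxν hS₁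
    hS₂ hβ0 hβ1 hε1 hεξ hdev₀

end Eq131

/-! ## §2 (1.42): the argument field of `ℍ_{j+1,□′}` (`22d²ε_{j+1}`, `loc_layer130_le` one scale up), sup output size -/

section Eq142

variable {g : B6.Geometry} {X : Type}
variable {𝔸 : Type} [NormedRing 𝔸] [NormedAlgebra ℂ 𝔸] [CompleteSpace 𝔸] [NormOneClass 𝔸]

/-- **(1.42) «≦ ½δ_j», ON THE LATTICE MODEL, FROM [15] (190) AND γ, ALL SIZES CONCRETE** —
`B15Ineq142From190.ineq142_le_half_lattice_of_ineq190_gamma'` at the INPUT size `bB := supSize g boxB blkB` on the bond index set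
`X` of the (1.30)-type tower of `ℍ_{j+1,□′}` (`j + 1` levels, fine field `U₀ = U^{(n+1)}_{j+1,□′}`, `V_{j+1} = M^{j+1}(U₀)`; `B i =
log[M^{j+1−dep i}(U₀)(b_i)((Q^{s*}_{dep i}M^{j+1}(U₀))(b_i))⁻¹]`), `hm` (`22d²ε_{j+1}`, p. 185 *"bounded on □′^{∼2} by
B₃exp(−δLM₂R_{j+1})22d²ε_{j+1}"* ⇐ the (1.30) sentence one scale up) DISCHARGED by `B15LayerSupSize.loc_layer130_le` at `j + 1`,
`hD` ↦ `hfar`, `κ = 1`; OUTPUT size `bout := supSize g box blk`, `ℍB := ℍ`, the dictionary `hdom` REPLACED by `hbox` (the box of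
the block `y` contains the sites of `B^j(b₋) ∪ B^j(b₊)` — set geometry).
[cite: Balaban1989LargeFieldI, (1.40)–(1.42) p.185; Balaban1985Variational, (190) p.308] -/
theorem ineq142_le_half_of_ineq190_layer
    (boxB : g.Site → Finset X) (blkB : X → g.Site) (dep : X → ℕ) (pt : X → B7Prop1Explicit.Site d) (dir : X → Fin d)
    (box : g.Site → Finset (B7Prop1Explicit.Site d)) (blk : B7Prop1Explicit.Site d → g.Site)
    {T : Type*} {dH : T → (X → 𝔸) →ₗ[ℝ] (B7Prop1Explicit.Site d → Fin d → 𝔸)} {C δ₀ σ τ c D : ℝ}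
    (h190 : ∀ t, Ineq190 (supSize (X := X) (E := 𝔸) g boxB blkB)
      (supSize (X := B7Prop1Explicit.Site d) (E := Fin d → 𝔸) g box blk) (dH t) C δ₀)
    (hC : 0 ≤ C) (hdist : ∀ a b : g.Site, 0 ≤ g.dist a b)
    (hrow : RowSum g σ c) (hτ : 0 ≤ τ) (hστ : σ + τ ≤ δ₀ / 8) (y : g.Site)
    {B₃ δ M₂ β₀ A₀ A₁ εj εj1 δj γ gj1 β : ℝ} {R r : ℕ}
    -- the tower of `ℍ_{j+1,□′}` (p29 `loc_layer130_le` at `j + 1`): fine field `U₀`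
    {L : ℕ} (hL : 2 ≤ L) (hd1 : 1 ≤ d) {G : Subgroup 𝔸ˣ} (hG : AvgClosed d L G) {j : ℕ}
    {U₀ : B7Prop1Explicit.Site d → Fin d → 𝔸ˣ} (hU₀ : ∀ x κ, U₀ x κ ∈ G)
    (hβ : 0 ≤ β) (hε' : 0 < εj1) (hε3 : C0 d * εj1 ≤ 1 / 3) (hε2 : 2 * εj1 ≤ c2' d L)
    (hεs : 11 * (d : ℝ) ^ 2 * εj1 ≤ 1 / 6) (lo hi : B7Prop1Explicit.Site d) (hlohi : lo ≤ hi)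
    (h124 : pdevOn (tlo L lo (j + 1)) (thi L hi (j + 1)) U₀ < (1 - β * (1 / 2)) * εj1 * (((L : ℝ) ^ (j + 1))⁻¹) ^ 2)
    (h15 : ∀ n, n < j + 1 → ∀ z, tlo L lo n ≤ z → z ≤ thi L hi n → ∀ r : Fin d → Fin L,
      axialFn (avgIter L U₀ (j + 1 - (n + 1))) ((L : ℤ) • z) ((L : ℤ) • z + boxVec L r) = 1)
    (hX : ∀ i, dep i ≤ j + 1 ∧ tlo L lo (dep i) ≤ pt i ∧ pt i + e (dir i) ≤ thi L hi (dep i))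
    (hfar : ∀ y' i, i ∈ boxB y' → D ≤ g.dist y y')
    -- the consumer side ((1.42) for the bond `(q, κ)` of the `L^j`-lattice)
    {Hf : B7Prop1Explicit.Site d → Fin d → 𝔸}
    (hmv : ∀ s : ℝ, (∀ t, (supSize (X := B7Prop1Explicit.Site d) (E := Fin d → 𝔸) g box blk).loc y (dH t
        (fun i => mlog (((avgIter L U₀ (j + 1 - dep i) (pt i) (dir i) *
          (pullIter L (avgIter L U₀ (j + 1)) (dep i) (pt i) (dir i))⁻¹ : 𝔸ˣ) : 𝔸)))) ≤ s) →
      (supSize (X := B7Prop1Explicit.Site d) (E := Fin d → 𝔸) g box blk).loc y Hf ≤ s)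
    {α₀ : ℝ} (hα : 0 < α₀) (hα3 : C0 d * α₀ ≤ 1 / 3) (hα4 : 4 * α₀ ≤ c2' d L)
    (h52 : pdev U₀ < α₀ * (((L : ℝ) ^ j)⁻¹) ^ 2) (q : B7Prop1Explicit.Site d) (κ : Fin d)
    (hgeom : δ * L * M₂ * R ≤ τ * D) (hCB : C * c ≤ B₃) (hB₃ : 0 ≤ B₃)
    (hbox : ∀ y', B7Prop1Local.InBox (B7Prop1Local.loK L j q) (B7Prop1Local.bondHiK L j q κ) y' → y' ∈ box y)
    (hflow : εj1 ≤ (1 + β₀) * εj) (hεδ : εj = A₀ / A₁ * δj) (hL1 : 1 ≤ L)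
    -- γ data
    (hr : 1 ≤ r) (hR : B14.IsRj L r gj1 R) (hg : 0 < gj1) (hgγ : gj1 ≤ γ) (hγe : 1 ≤ Real.log (γ ^ 2)⁻¹)
    (hc1 : 1 ≤ δ * L * M₂) (hβ₀ : 0 ≤ 1 + β₀) (hA : 0 ≤ A₀ / A₁) (hδj : 0 ≤ δj)
    (hγ : (68 * ((d : ℝ) + 1) + 160 * d) * B₃ * (22 * d ^ 2) * (1 + β₀) * (A₀ / A₁) * γ ^ 2 ≤ 1 / 2)
    (hεj1 : εj ≤ 1)
    (hsmγ : 2048 * (d : ℝ) * (B₃ * (22 * (d : ℝ) ^ 2) * (1 + β₀) * γ ^ 2) ≤ 1)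
    (hc₃γ : 2 * (B₃ * (22 * (d : ℝ) ^ 2) * (1 + β₀) * γ ^ 2) ≤ c3 d L)
    (hsmallγ : Real.exp (4 * (800 * ((d : ℝ) + 1) ^ 2 * ((d : ℝ) + 4)) * α₀)
      * (1 + 8 * (131072 * ((d : ℝ) + 1) ^ 2) * (B₃ * (22 * (d : ℝ) ^ 2) * (1 + β₀) * γ ^ 2)) ≤ 2) :
    ‖((avgIter L
          (gaugeAct (B7Eq84Concrete.glev L hL1 U₀
              (expCfg (fun y μ => ((Complex.I : ℂ) * ((((L : ℝ) ^ (j + 1))⁻¹ : ℝ) : ℂ)) • Hf y μ)) j 0)⁻¹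
            (expCfg (fun y μ => ((Complex.I : ℂ) * ((((L : ℝ) ^ (j + 1))⁻¹ : ℝ) : ℂ)) • Hf y μ) * U₀)) j q κ : 𝔸ˣ) : 𝔸)
        * (((avgIter L U₀ j q κ)⁻¹ : 𝔸ˣ) : 𝔸) - 1‖ ≤ δj / 2 :=
  ineq142_le_half_lattice_of_ineq190_gamma' h190 hC hdist hrow hτ hστ _ y
    (loc_layer130_le boxB blkB dep pt dir L hL hd1 hG (j + 1) U₀ hU₀ hβ hε' hε3 hε2 hεs lo hi hlohi h124 h15 hX)
    (fun y' hne => by obtain ⟨i, hi, -⟩ := exists_ne_zero_of_loc_ne_zero hne; exact hfar y' i hi)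
    hmv hL hG hU₀ hα hα3 hα4 h52 q κ hgeom (by rw [supSize_κ, mul_one]; exact hCB) hB₃ hε'.le
    (fun y' μ hy => norm_apply_apply_le_loc (hbox y' hy) Hf μ) hflow hεδ hL1 hr hR hg hgγ hγe hc1 hβ₀ hA hδj hγ hd1 hεj1
    hsmγ hc₃γ hsmallγ

end Eq142

/-! ## §3 (1.37)–(1.39): the THREE pieces of the (1.34) argument field, sup output size -/

section Eq139

variable {gB : B6.Geometry} {X : Type}
variable {𝔸 : Type} [NormedRing 𝔸] [NormedAlgebra ℂ 𝔸] [CompleteSpace 𝔸] [NormOneClass 𝔸]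

/-- **p. 185 «lhs of (1.37) ≤ ½δ_j», ON THE LATTICE MODEL, FROM [15] (190) AND γ, ALL SIZES CONCRETE** —
`B15Ineq139From190.ineq139_half_lattice_of_ineq190_gamma'` at the INPUT size `bB := supSize gB boxB blkB` on ONE bond index set `X`
carrying print's two regions of the determining set of (1.34) (tag `rg`): `rg i = true` = the `Ω_{j+1}∩Z_{j+1}` tower (`j + 1`
levels in `[lo₁, hi₁]`, field `F₁ i = log[M^{j+1−dep i}(U₀)(b_i)((Q^{s*}_{dep i}M^{j+1}(U₀))(b_i))⁻¹]`, *"equal to 0 … On the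
boundary layer it can be bounded by 22d²ε_{j+1}"*), `rg i = false` = the `Ω^c_{j+1}∩Z^c_j` tower (`j` levels in `[lo₂, hi₂]`, top
field `V = V_j` with (1.27) `|V_j(b)(V_Z^{(j)}(b))⁻¹ − 1| < 2δ′_j`, `V_Z^{(j)} = M^j(U₀)`; field `F₂ i = log[(Q^{s*}_{dep i}V)(b_i)
(M^{j−dep i}(U₀)(b_i))⁻¹]`, *"equal to (1/i)log[V_j(V_Z^{(j)})⁻¹], hence … 4δ′_j … On the boundary layer … 22d²ε_j"*); the three
pieces `B₁ :=` the top-type part of `F₂` (`dep i = 0`, size `4δ′_j` by `B14ArgField36Lattice.argField145_lt`, no localisation),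
`B₂ := F₁` on the first region (size `22d²ε_{j+1}` by `B15LayerLocal.layer130_lt_local`, far `≥ MR_{j+1}`: `hfar₂`), `B₃ :=` the
finer part of `F₂` (`dep i ≠ 0`, size `22d²ε_j` by `B15LayerSupSize.layer138_Zc_le_local`, far `≥ 6LMR_{j+1}`: `hfar₃`), `B₁ + B₂
+ B₃ =` the whole field; `κ = 1`; OUTPUT size `bout := supSize gB box blk`, `ℍB := ℍ`, `hdom` ↦ `hbox`.  Fine field `U₀ =
U_k^{(n+1)}` SHARED by both towers and the consumer ((1.35)–(1.37)).
[cite: Balaban1989LargeFieldI, (1.34)–(1.39) pp.184–185, (1.27) p.183; Balaban1985Variational, (190) p.308] -/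
theorem ineq139_half_of_ineq190_layer
    (boxB : gB.Site → Finset X) (blkB : X → gB.Site) (rg : X → Bool) (dep : X → ℕ) (pt : X → B7Prop1Explicit.Site d)
    (dir : X → Fin d)
    (box : gB.Site → Finset (B7Prop1Explicit.Site d)) (blk : B7Prop1Explicit.Site d → gB.Site)
    {T : Type*} {dH : T → (X → 𝔸) →ₗ[ℝ] (B7Prop1Explicit.Site d → Fin d → 𝔸)} {C δ₀ σ τ c : ℝ}
    (h190 : ∀ t, Ineq190 (supSize (X := X) (E := 𝔸) gB boxB blkB)
      (supSize (X := B7Prop1Explicit.Site d) (E := Fin d → 𝔸) gB box blk) (dH t) C δ₀)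
    (hC : 0 ≤ C) (hdist : ∀ a b : gB.Site, 0 ≤ gB.dist a b)
    (hrow : RowSum gB σ c) (hτ : 0 ≤ τ) (hστ : σ + τ ≤ δ₀ / 8) (y : gB.Site)
    -- the two towers (p29), fine field `U₀` shared
    {L : ℕ} (hL : 2 ≤ L) (hd1 : 1 ≤ d) {G : Subgroup 𝔸ˣ} (hG : AvgClosed d L G) {j : ℕ}
    {U₀ : B7Prop1Explicit.Site d → Fin d → 𝔸ˣ} (hU₀ : ∀ x κ, U₀ x κ ∈ G)
    {B₃ δ'j M εj εj1 β₀ A₀ A₁ δj γ gj gj1 β : ℝ} {R r p₀ p₁ : ℕ}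
    -- region `Ω_{j+1} ∩ Z_{j+1}`: `j + 1` levels, (1.24) with `c = 1` on the finest cube
    (hβ : 0 ≤ β) (hε1' : 0 < εj1) (hε3' : C0 d * εj1 ≤ 1 / 3) (hε2' : 2 * εj1 ≤ c2' d L)
    (hεs' : 11 * (d : ℝ) ^ 2 * εj1 ≤ 1 / 6) (lo₁ hi₁ : B7Prop1Explicit.Site d) (hlohi₁ : lo₁ ≤ hi₁)
    (h124₁ : pdevOn (tlo L lo₁ (j + 1)) (thi L hi₁ (j + 1)) U₀ < (1 - β * (1 / 2)) * εj1 * (((L : ℝ) ^ (j + 1))⁻¹) ^ 2)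
    (h15₁ : ∀ n, n < j + 1 → ∀ z, tlo L lo₁ n ≤ z → z ≤ thi L hi₁ n → ∀ r : Fin d → Fin L,
      axialFn (avgIter L U₀ (j + 1 - (n + 1))) ((L : ℤ) • z) ((L : ℤ) • z + boxVec L r) = 1)
    (hX₁ : ∀ i, rg i = true → dep i ≤ j + 1 ∧ tlo L lo₁ (dep i) ≤ pt i ∧ pt i + e (dir i) ≤ thi L hi₁ (dep i))
    -- region `Ω^c_{j+1} ∩ Z^c_j`: `j` levels, (1.24) on the finest cube, (1.27) on the top cube, `6δ′_j ≤ ε_j`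
    (hε : 0 < εj) (hε3 : C0 d * εj ≤ 1 / 3) (hε2 : 2 * εj ≤ c2' d L) (lo₂ hi₂ : B7Prop1Explicit.Site d) (hlohi₂ : lo₂ ≤ hi₂)
    (h124₂ : pdevOn (tlo L lo₂ j) (thi L hi₂ j) U₀ < εj * (((L : ℝ) ^ j)⁻¹) ^ 2)
    (V : B7Prop1Explicit.Site d → Fin d → 𝔸ˣ) (hV : ∀ x μ, V x μ ∈ U1 𝔸) (hδ0 : 0 ≤ δ'j) (hδε : 6 * δ'j ≤ εj)
    (hs : 2 * δ'j + 11 * (d : ℝ) ^ 2 * εj ≤ 1 / 6) (hδ2 : 2 * δ'j ≤ 1 / 2)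
    (h15₂ : ∀ n, n < j → ∀ z, tlo L lo₂ n ≤ z → z ≤ thi L hi₂ n → ∀ r : Fin d → Fin L,
      axialFn (avgIter L U₀ (j - (n + 1))) ((L : ℤ) • z) ((L : ℤ) • z + boxVec L r) = 1)
    (h127 : ∀ x ν, lo₂ ≤ x → x + e ν ≤ hi₂ → ‖((V x ν * (avgIter L U₀ j x ν)⁻¹ : 𝔸ˣ) : 𝔸) - 1‖ < 2 * δ'j)
    (hX₂ : ∀ i, rg i = false → dep i ≤ j ∧ tlo L lo₂ (dep i) ≤ pt i ∧ pt i + e (dir i) ≤ thi L hi₂ (dep i))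
    -- localisation, now geometry: blocks whose box carries a bond of the first region are `≥ MR` from `y`, blocks whose box
    -- carries a finer bond of the second region are `≥ 6LMR` from `y`
    (hfar₂ : ∀ y' i, i ∈ boxB y' → rg i = true → M * R ≤ gB.dist y y')
    (hfar₃ : ∀ y' i, i ∈ boxB y' → rg i = false → dep i ≠ 0 → 6 * (L : ℝ) * M * R ≤ gB.dist y y')
    -- the consumer side ((1.37) for the bond `(q, κ)` of the `L^j`-lattice)
    {α₀ : ℝ} (hα : 0 < α₀) (hα3 : C0 d * α₀ ≤ 1 / 3) (hα4 : 4 * α₀ ≤ c2' d L)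
    (h52 : pdev U₀ < α₀ * (((L : ℝ) ^ j)⁻¹) ^ 2)
    (H : B7Prop1Explicit.Site d → Fin d → 𝔸) (q : B7Prop1Explicit.Site d) (κ : Fin d)
    (hmv : ∀ s : ℝ, (∀ t, (supSize (X := B7Prop1Explicit.Site d) (E := Fin d → 𝔸) gB box blk).loc y (dH t
        (fun i => if rg i then
            mlog (((avgIter L U₀ (j + 1 - dep i) (pt i) (dir i) *
              (pullIter L (avgIter L U₀ (j + 1)) (dep i) (pt i) (dir i))⁻¹ : 𝔸ˣ) : 𝔸))
          else
            mlog (((pullIter L V (dep i) (pt i) (dir i) *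
              (avgIter L U₀ (j - dep i) (pt i) (dir i))⁻¹ : 𝔸ˣ) : 𝔸)))) ≤ s) →
      (supSize (X := B7Prop1Explicit.Site d) (E := Fin d → 𝔸) gB box blk).loc y H ≤ s)
    (hCB : C * c < B₃) (hB₃ : 0 ≤ B₃)
    (hbox : ∀ y', B7Prop1Local.InBox (B7Prop1Local.loK L j q) (B7Prop1Local.bondHiK L j q κ) y' → y' ∈ box y)
    (hL1 : 1 ≤ L)
    -- the located conditions in γ/α₀ form (`S_γ = A₁(4p₀)^{p₀}√γ / (2·(136(d+1)+320d))`)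
    (hA₁0 : 0 ≤ A₁) (hp₀1 : 1 ≤ p₀) (hγ1 : γ ≤ 1)
    (hsmγ : 2048 * (d : ℝ) * (A₁ * (4 * (p₀ : ℝ)) ^ p₀ * Real.sqrt γ / (2 * (136 * ((d : ℝ) + 1) + 320 * d))) ≤ 1)
    (hc₃γ : 2 * (A₁ * (4 * (p₀ : ℝ)) ^ p₀ * Real.sqrt γ / (2 * (136 * ((d : ℝ) + 1) + 320 * d))) ≤ c3 d L)
    (hsmallγ : Real.exp (4 * (800 * ((d : ℝ) + 1) ^ 2 * ((d : ℝ) + 4)) * α₀)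
      * (1 + 8 * (131072 * ((d : ℝ) + 1) ^ 2)
        * (A₁ * (4 * (p₀ : ℝ)) ^ p₀ * Real.sqrt γ / (2 * (136 * ((d : ℝ) + 1) + 320 * d)))) ≤ 2)
    -- (1.38)₂,₃ data
    (hflow : εj1 ≤ (1 + 2 * β₀) * εj) (hA₁ : A₁ ≠ 0) (hp₀v : logPow p₀ gj ≠ 0)
    (hδ' : δ'j = gj * A₁ * logPow p₁ gj) (hεj : εj = gj * A₀ * logPow p₀ gj) (hδj : δj = gj * A₁ * logPow p₀ gj)
    -- γ data
    (hr : 1 ≤ r) (hp : p₁ < p₀) (hgj : 0 < gj) (hgjγ : gj ≤ γ) (hR : B14.IsRj L r gj1 R) (hgj1 : 0 < gj1)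
    (hgj1γ : gj1 ≤ γ) (hγe : 1 ≤ Real.log (γ ^ 2)⁻¹) (hτM : 1 ≤ τ * M)
    (hK : 0 ≤ 44 * (d : ℝ) ^ 2 * (1 + β₀) * (A₀ / A₁)) (hδj0 : 0 ≤ δj) (hδ'j : 0 < δ'j)
    (hγ : (136 * ((d : ℝ) + 1) + 320 * d) * B₃
      * (4 * (Real.log (γ ^ 2)⁻¹)⁻¹ + 44 * (d : ℝ) ^ 2 * (1 + β₀) * (A₀ / A₁) * γ ^ 2) ≤ 1 / 2) :
    ‖((avgIter L
          (gaugeAct (B7Eq84Concrete.glev L hL1 U₀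
              (expCfg (fun y μ => ((Complex.I : ℂ) * ((((L : ℝ) ^ j)⁻¹ : ℝ) : ℂ)) • H y μ)) j 0)⁻¹
            (expCfg (fun y μ => ((Complex.I : ℂ) * ((((L : ℝ) ^ j)⁻¹ : ℝ) : ℂ)) • H y μ) * U₀)) j q κ : 𝔸ˣ) : 𝔸)
        * (((avgIter L U₀ j q κ)⁻¹ : 𝔸ˣ) : 𝔸) - 1‖ ≤ δj / 2 := by
  -- print's two formulas (the two regions) and three pieces
  set F₁ : X → 𝔸 := fun i => mlog (((avgIter L U₀ (j + 1 - dep i) (pt i) (dir i) *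
    (pullIter L (avgIter L U₀ (j + 1)) (dep i) (pt i) (dir i))⁻¹ : 𝔸ˣ) : 𝔸)) with hF₁
  set F₂ : X → 𝔸 := fun i => mlog (((pullIter L V (dep i) (pt i) (dir i) *
    (avgIter L U₀ (j - dep i) (pt i) (dir i))⁻¹ : 𝔸ˣ) : 𝔸)) with hF₂
  set P₁ : X → 𝔸 := fun i => if rg i then 0 else (if dep i = 0 then F₂ i else 0) with hP₁
  set P₂ : X → 𝔸 := fun i => if rg i then F₁ i else 0 with hP₂
  set P₃ : X → 𝔸 := fun i => if rg i then 0 else (if dep i = 0 then 0 else F₂ i) with hP₃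
  have hsplit : P₁ + P₂ + P₃ = fun i => if rg i then F₁ i else F₂ i := by
    funext i
    simp only [hP₁, hP₂, hP₃, Pi.add_apply]
    split_ifs <;> simp
  -- piece 1: the top-type bonds of the second region, `4δ′_j` by (1.27) (`argField145_lt`), no localisation
  have hm₁ : ∀ y', (supSize (X := X) (E := 𝔸) gB boxB blkB).loc y' P₁ ≤ 4 * δ'j :=
    fun y' => loc_le_of_forall (by positivity) fun i _ => by
      by_cases hr1 : rg i = true
      · simp only [hP₁, hr1, if_true, norm_zero]
        positivity
      · have hr0 : rg i = false := by simpa using hr1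
        by_cases h0 : dep i = 0
        · obtain ⟨-, hlo, hhi⟩ := hX₂ i hr0
          rw [h0, tlo_zero] at hlo
          rw [h0, thi_zero] at hhi
          simp only [hP₁, hr0, h0, if_true, hF₂, pullIter_zero, Nat.sub_zero, Bool.false_eq_true, if_false]
          exact (argField145_lt _ _ hδ2 (h127 (pt i) (dir i) hlo hhi)).le
        · simp only [hP₁, hr0, h0, if_false, Bool.false_eq_true, norm_zero]
          positivity
  have hD₁ : ∀ y', (supSize (X := X) (E := 𝔸) gB boxB blkB).loc y' P₁ ≠ 0 → 0 ≤ gB.dist y y' :=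
    fun y' _ => hdist y y'
  -- piece 2: the first region, `22d²ε_{j+1}` (`layer130_lt_local` at `j + 1`), far `≥ MR`
  have hm₂ : ∀ y', (supSize (X := X) (E := 𝔸) gB boxB blkB).loc y' P₂ ≤ 22 * (d : ℝ) ^ 2 * εj1 :=
    fun y' => loc_le_of_forall (by positivity) fun i _ => by
      by_cases hr1 : rg i = true
      · obtain ⟨hdp, hlo, hhi⟩ := hX₁ i hr1
        simp only [hP₂, hr1, if_true, hF₁]
        exact (layer130_lt_local L hL hd1 hG (j + 1) U₀ hU₀ hβ hε1' hε3' hε2' hεs' lo₁ hi₁ hlohi₁ h124₁ h15₁ (dep i) hdp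
          (pt i) (dir i) hlo hhi).le
      · have hr0 : rg i = false := by simpa using hr1
        simp only [hP₂, hr0, Bool.false_eq_true, if_false, norm_zero]
        positivity
  have hD₂ : ∀ y', (supSize (X := X) (E := 𝔸) gB boxB blkB).loc y' P₂ ≠ 0 → M * R ≤ gB.dist y y' :=
    fun y' hne => by
      obtain ⟨i, hi, hne'⟩ := exists_ne_zero_of_loc_ne_zero hne
      by_cases hr1 : rg i = true
      · exact hfar₂ y' i hi hr1
      · have hr0 : rg i = false := by simpa using hr1
        exact absurd (by simp only [hP₂, hr0, Bool.false_eq_true, if_false]) hne'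
  -- piece 3: the finer bonds of the second region, `22d²ε_j` (`layer138_Zc_le_local`), far `≥ 6LMR`
  have hm₃ : ∀ y', (supSize (X := X) (E := 𝔸) gB boxB blkB).loc y' P₃ ≤ 22 * (d : ℝ) ^ 2 * εj :=
    fun y' => loc_le_of_forall (by positivity) fun i _ => by
      by_cases hr1 : rg i = true
      · simp only [hP₃, hr1, if_true, norm_zero]
        positivity
      · have hr0 : rg i = false := by simpa using hr1
        by_cases h0 : dep i = 0
        · simp only [hP₃, hr0, h0, if_true, Bool.false_eq_true, if_false, norm_zero]
          positivity
        · obtain ⟨hdp, hlo, hhi⟩ := hX₂ i hr0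
          simp only [hP₃, hr0, h0, if_false, Bool.false_eq_true, hF₂]
          exact (layer138_Zc_le_local L hL hd1 hG j U₀ hU₀ hε hε3 hε2 lo₂ hi₂ hlohi₂ h124₂ V hV hδ0 hδε hs h15₂ h127
            (dep i) hdp (pt i) (dir i) hlo hhi).2
  have hD₃ : ∀ y', (supSize (X := X) (E := 𝔸) gB boxB blkB).loc y' P₃ ≠ 0 → 6 * (L : ℝ) * M * R ≤ gB.dist y y' :=
    fun y' hne => by
      obtain ⟨i, hi, hne'⟩ := exists_ne_zero_of_loc_ne_zero hne
      by_cases hr1 : rg i = true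
      · exact absurd (by simp only [hP₃, hr1, if_true]) hne'
      · have hr0 : rg i = false := by simpa using hr1
        by_cases h0 : dep i = 0
        · exact absurd (by simp only [hP₃, hr0, h0, if_true, Bool.false_eq_true, if_false]) hne'
        · exact hfar₃ y' i hi hr0 h0
  exact ineq139_half_lattice_of_ineq190_gamma' h190 hC hdist hrow hτ hστ y hL hG hU₀ hα hα3 hα4 h52 H q κ hm₁ hD₁ hm₂ hD₂
    hm₃ hD₃ (fun s hs' => hmv s fun t => by simpa only [hsplit] using hs' t) hδ'j hε.le hε1'.le
    (by rw [supSize_κ, mul_one]; exact hCB) hB₃ (fun y' μ hy => norm_apply_apply_le_loc (hbox y' hy) H μ) hL1 hd1 hA₁0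
    hp₀1 hγ1 hsmγ hc₃γ hsmallγ hflow hA₁ hp₀v hδ' hεj hδj hr hp hgj hgjγ hR hgj1 hgj1γ hγe hτM hK hδj0 hγ

end Eq139

/-! ## §4 (1.90) ⇒ (1.91): the argument field of `ℍ_{h,□}` (`11d²ε_h`, `loc_layer190_le`), sup and covariant-derivative
output sizes (two-sup reading) -/

section Eq191

variable {gB : B6.Geometry} {X : Type}
variable {𝔸 : Type} [CStarAlgebra 𝔸] [Nontrivial 𝔸]

/-- **(1.90) ⇒ (1.91) ON THE LATTICE, FROM [15] (190) AND γ, ALL SIZES CONCRETE (two-sup reading, `α ↦ 2α`)** —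
`B15Ineq191From190.ineq191_lattice_twoSup_of_ineq190_gamma` at the INPUT size `bB := supSize gB boxB blkB` on the bond index set
`X` of p29's (1.90) tower (`K` levels below `T^{(h)}`, fine field `U₀ = U″_{k,Z}`, top `M^K(U₀) = V″`-type; `B i =
log[M^{K−dep i}(U₀)(b_i)((Q^{s*}_{dep i}M^K(U₀))(b_i))⁻¹]`), `hm` (*"can be bounded … 11d²ε_h"* ⇐ the plaquette bound `½ε_hξ²` on
the finest cube) DISCHARGED by `B15LayerSupSize.loc_layer190_le`, `hD` ↦ `hfar`, `κ = 1`; OUTPUT sizes `bout₀ := supSize gB box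
blk`, `bout₁ := covDerivBlockSize gB y₀ S ξ U₀`, `ℍB := ℍ`: the six dictionary hypotheses REPLACED by membership.
[cite: Balaban1989LargeFieldI, (1.90)–(1.91) p.198; Balaban1985Variational, (190) p.308] -/
theorem ineq191_twoSup_of_ineq190_layer
    (boxB : gB.Site → Finset X) (blkB : X → gB.Site) (dep : X → ℕ) (pt : X → B7Prop1Explicit.Site d) (dir : X → Fin d)
    (box : gB.Site → Finset (B7Prop1Explicit.Site d)) (blk : B7Prop1Explicit.Site d → gB.Site)
    (y₀ : gB.Site) (S : gB.Site → Finset (B7Prop1Explicit.Site d × Fin d × Fin d))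
    {T : Type*} {dH : T → (X → 𝔸) →ₗ[ℝ] (B7Prop1Explicit.Site d → Fin d → 𝔸)}
    {C δ₀ σ τ c D B₃ δ M₂ εh γ gh α : ℝ} {r R : ℕ}
    {ξ : ℝ} {L : ℕ} {K : ℕ} {U₀ : B7Prop1Explicit.Site d → Fin d → 𝔸ˣ}
    (h190₀ : ∀ t, Ineq190 (supSize (X := X) (E := 𝔸) gB boxB blkB)
      (supSize (X := B7Prop1Explicit.Site d) (E := Fin d → 𝔸) gB box blk) (dH t) C δ₀)
    (h190₁ : ∀ t, Ineq190 (supSize (X := X) (E := 𝔸) gB boxB blkB) (covDerivBlockSize gB y₀ S ξ U₀) (dH t) C δ₀)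
    (hC : 0 ≤ C) (hdist : ∀ a b : gB.Site, 0 ≤ gB.dist a b) (hrow : RowSum gB σ c) (hτ : 0 ≤ τ) (hστ : σ + τ ≤ δ₀ / 8)
    (y : gB.Site)
    -- the (1.90) tower of p29 (`loc_layer190_le`): fine field `U₀`, `K` levels
    (hL : 2 ≤ L) (hd1 : 1 ≤ d) {G : Subgroup 𝔸ˣ} (hG : AvgClosed d L G) (hU₀ : ∀ x κ, U₀ x κ ∈ G) (hε : 0 < εh)
    (hs3 : C0 d * (εh * (1 / 2)) ≤ 1 / 3) (hs2 : 2 * (εh * (1 / 2)) ≤ c2' d L)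
    (hs : 11 * (d : ℝ) ^ 2 * (εh * (1 / 2)) ≤ 1 / 6) (lo hi : B7Prop1Explicit.Site d) (hlohi : lo ≤ hi)
    (h190p : pdevOn (tlo L lo K) (thi L hi K) U₀ < εh * (1 / 2) * (((L : ℝ) ^ K)⁻¹) ^ 2)
    (h15 : ∀ n, n < K → ∀ z, tlo L lo n ≤ z → z ≤ thi L hi n → ∀ r : Fin d → Fin L,
      axialFn (avgIter L U₀ (K - (n + 1))) ((L : ℤ) • z) ((L : ℤ) • z + boxVec L r) = 1)
    (hX : ∀ i, dep i ≤ K ∧ tlo L lo (dep i) ≤ pt i ∧ pt i + e (dir i) ≤ thi L hi (dep i))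
    (hfar : ∀ y' i, i ∈ boxB y' → D ≤ gB.dist y y')
    -- the consumer side ((1.91) for the plaquette `p_{μν}(x)`)
    (hξ : 0 < ξ) {H : B7Prop1Explicit.Site d → Fin d → 𝔸} (hH : ∀ z κ, IsSelfAdjoint (H z κ))
    {g : B7Prop1Explicit.Site d → 𝔸ˣ} (hg : ∀ z, g z ∈ U1 𝔸) (μ ν : Fin d) (x : B7Prop1Explicit.Site d) {Linv : ℝ}
    (hmv₀ : ∀ s : ℝ, (∀ t, (supSize (X := B7Prop1Explicit.Site d) (E := Fin d → 𝔸) gB box blk).loc y (dH t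
        (fun i => mlog (((avgIter L U₀ (K - dep i) (pt i) (dir i) *
          (pullIter L (avgIter L U₀ K) (dep i) (pt i) (dir i))⁻¹ : 𝔸ˣ) : 𝔸)))) ≤ s) →
      (supSize (X := B7Prop1Explicit.Site d) (E := Fin d → 𝔸) gB box blk).loc y H ≤ s)
    (hmv₁ : ∀ s : ℝ, (∀ t, (covDerivBlockSize gB y₀ S ξ U₀).loc y (dH t
        (fun i => mlog (((avgIter L U₀ (K - dep i) (pt i) (dir i) *
          (pullIter L (avgIter L U₀ K) (dep i) (pt i) (dir i))⁻¹ : 𝔸ˣ) : 𝔸)))) ≤ s) →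
      (covDerivBlockSize gB y₀ S ξ U₀).loc y H ≤ s)
    (hgeom : δ * 2 * L * M₂ * R ≤ τ * D) (hCB : C * c ≤ B₃) (hB₃ : 0 < B₃)
    -- γ data
    (hr : 1 ≤ r) (hR : B14.IsRj L r gh R) (hgh : 0 < gh) (hgγ : gh ≤ γ) (hγe : 1 ≤ Real.log (γ ^ 2)⁻¹)
    (hc1 : 1 < δ * 2 * L * M₂) (hRh : 0 < (R : ℝ)) (hγ : 11 * (d : ℝ) ^ 2 * B₃ * γ ^ 2 < α)
    -- the output dictionaries, now set geometry
    (hx : x ∈ box y) (hxμ : x + e μ ∈ box y) (hxν : x + e ν ∈ box y)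
    (hS₁ : (x, μ, ν) ∈ S y) (hS₂ : (x, ν, μ) ∈ S y) (hLinv : 0 ≤ Linv) :
    B15.PrelimIntegrations.Ineq191 ‖B8Ineq132.plaqF (gaugeAct g (B8Lemma1NonAbelian.mulCfg (B8Eq146AExpansion.expCfg
        (B8Eq146AExpansion.iEta ξ H)) U₀)) μ ν x - 1‖ ‖B8Ineq132.plaqF U₀ μ ν x - 1‖ (2 * α) Linv εh (εh * ξ ^ 2) := by
  have hdpos : 0 < d := hd1
  exact ineq191_lattice_twoSup_of_ineq190_gamma h190₀ h190₁ hC hdist hrow hτ hστ _ y hξ (fun z κ => hG.le_U1 (hU₀ z κ)) hH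
    hg μ ν x
    (loc_layer190_le boxB blkB dep pt dir L hL hd1 hG K U₀ hU₀ hε hs3 hs2 hs lo hi hlohi h190p h15 hX)
    (fun y' hne => by obtain ⟨i, hi, -⟩ := exists_ne_zero_of_loc_ne_zero hne; exact hfar y' i hi)
    hmv₀ hmv₁ hgeom (by rw [supSize_κ, mul_one]; exact hCB) hB₃ hr hR hgh hgγ hγe hc1 hRh hdpos hε hγ
    (norm_apply_apply_le_loc hx H μ) (norm_apply_apply_le_loc hxμ H ν) (norm_apply_apply_le_loc hxν H μ)
    (norm_apply_apply_le_loc hx H ν) (norm_covDerivFwd_le_loc hS₁ H) (norm_covDerivFwd_le_loc hS₂ H) hLinv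

end Eq191

/-! ## §5 (v1.1) (1.45)–(1.48): the (1.44) argument field (`4δ′_j`, `loc_top_le`), WEIGHTED output sizes `L^iη·sup|ℍ|`,
`(L^iη)²·sup|∇ℍ|` -/

section Weighted

variable {gB : B6.Geometry}
variable {𝔸 : Type} [CStarAlgebra 𝔸] [Nontrivial 𝔸]

omit [Nontrivial 𝔸] in
/-- The weighted function-size dictionary: for `0 ≤ w` and `x ∈ box y`, `w·‖ℍ(x,μ)‖ ≤ (supSize).loc y (w • ℍ)` — the size
*"sup_{B^i(y)} L^iη|ℍ|"* of (1.45) read as the plain sup size of the rescaled function. [folklore] -/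
private theorem weighted_sup_dict {box : gB.Site → Finset (B7Prop1Explicit.Site d)} {blk : B7Prop1Explicit.Site d → gB.Site}
    {w : ℝ} (hw : 0 ≤ w) {y : gB.Site} {x : B7Prop1Explicit.Site d} (hx : x ∈ box y)
    (H : B7Prop1Explicit.Site d → Fin d → 𝔸) (μ : Fin d) :
    w * ‖H x μ‖ ≤ (supSize (X := B7Prop1Explicit.Site d) (E := Fin d → 𝔸) gB box blk).loc y (w • H) := by
  have h := norm_apply_apply_le_loc (box := box) (blk := blk) hx (w • H) μ
  rwa [Pi.smul_apply, Pi.smul_apply, norm_smul, Real.norm_eq_abs, abs_of_nonneg hw] at h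

omit [Nontrivial 𝔸] in
/-- The inversely weighted function-size dictionary: for `0 < w` and `x ∈ box y`, `‖ℍ(x,μ)‖ ≤ w·(supSize).loc y (w⁻¹ • ℍ)` — the
size *"(L^{j+1}η)|ℍ|"* of (1.57) with `w = (L^{j+1}η)⁻¹ = L^{k−j−1}`. [folklore] -/
private theorem inv_weighted_sup_dict {box : gB.Site → Finset (B7Prop1Explicit.Site d)} {blk : B7Prop1Explicit.Site d → gB.Site}
    {w : ℝ} (hw : 0 < w) {y : gB.Site} {x : B7Prop1Explicit.Site d} (hx : x ∈ box y)
    (H : B7Prop1Explicit.Site d → Fin d → 𝔸) (μ : Fin d) :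
    ‖H x μ‖ ≤ w * (supSize (X := B7Prop1Explicit.Site d) (E := Fin d → 𝔸) gB box blk).loc y (w⁻¹ • H) := by
  have h := weighted_sup_dict (box := box) (blk := blk) (inv_nonneg.mpr hw.le) hx H μ
  have h2 := mul_le_mul_of_nonneg_left h hw.le
  rwa [← mul_assoc, mul_inv_cancel₀ hw.ne', one_mul] at h2

omit [Nontrivial 𝔸] in
/-- The weighted covariant-derivative-size dictionary: for `0 ≤ w` and `(x,μ,ν) ∈ S y`, `w²·‖(∇^η_{U₀,μ}ℍ_ν)(x)‖ ≤
(ofSeminorms gB y₀ (w.toNNReal • covDerivSize (S ·) η U₀)).loc y (w • ℍ)` — the size *"sup_{B^i(y)} (L^iη)²|∇^η ℍ|"* of (1.45) as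
the scaled first-order seminorm of r11's `B11SeminormSize190` at the rescaled function. [folklore] -/
private theorem weighted_cov_dict {y₀ : gB.Site} {S : gB.Site → Finset (B7Prop1Explicit.Site d × Fin d × Fin d)} {η w : ℝ}
    (hw : 0 ≤ w) {U₀ : B7Prop1Explicit.Site d → Fin d → 𝔸ˣ} {y : gB.Site} {x : B7Prop1Explicit.Site d} {μ ν : Fin d}
    (ht : (x, μ, ν) ∈ S y) (H : B7Prop1Explicit.Site d → Fin d → 𝔸) :
    w ^ 2 * ‖B8Ineq132.covDerivFwd η U₀ μ (fun z => H z ν) x‖ ≤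
      (ofSeminorms gB y₀ (fun y => w.toNNReal • covDerivSize (S y) η U₀)).loc y (w • H) := by
  change w ^ 2 * _ ≤ (w.toNNReal • covDerivSize (S y) η U₀) (w • H)
  rw [smul_apply, NNReal.smul_def, smul_eq_mul, Real.coe_toNNReal _ hw, map_smul_eq_mul, Real.norm_eq_abs,
    abs_of_nonneg hw, pow_two, mul_assoc]
  exact mul_le_mul_of_nonneg_left (mul_le_mul_of_nonneg_left (norm_covDerivFwd_le_covDerivSize ht H) hw) hw

variable {X : Type}

/-- **(1.46) ⇒ (1.48) ON THE LATTICE MODEL, FROM [15] (190), (1.47)'s distance input AND γ, ALL SIZES CONCRETE** —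
`B15Ineq148From190.ineq148_lattice_of_ineq190_gamma'` at the INPUT size `bB := supSize gB boxB blkB` on the index set `X` of the top
bonds `b_i = ⟨pt i, pt i + e_{dir i}⟩ ⊂ [lo, hi]` of `(Ω^c_{j+1}∖Z″_{j+1})^{(j)}` carrying the (1.44) argument field `B i =
log[V_j(b_i)(V_Z^{(j)}(b_i))⁻¹]` (`V = V_j`, `A = V_Z^{(j)}`; p. 186 *"The field in the argument of the function ℍ^{(n)}_k is bounded by
4δ′_j, and is localized in the domain Ω^c_{j+1}∖Z″_{j+1}"*): `hm` DISCHARGED by `B15LayerSupSize.loc_top_le` from (1.27) `|V_j(b)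
(V_Z^{(j)}(b))⁻¹ − 1| < 2δ′_j` on `[lo, hi]` (`2δ′_j ≤ ½`), `hD` ↦ `hfar` (every block whose box carries a bond of the field is `≥ dist`
from `y`, `dist = d(y, Ω^c_{j+1}∖Z″_{j+1})`), `κ = 1`; OUTPUT sizes with print's weights (1.45): `bout₀ := supSize gB box blk` and
`bout₁ := ofSeminorms gB y₀ (L^iη · covDerivSize (S ·) η U₀)` both evaluated at the rescaled function `ℍB := (L^iη) • ℍ` (so
`bout₀.loc y ℍB = sup (L^iη)|ℍ|`, `bout₁.loc y ℍB = (L^iη)²·max|∇^η_{U₀}ℍ|`): the six weighted dictionary hypotheses REPLACED by the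
membership of `x, x + e_μ, x + e_ν` in `box y` and of `(x,μ,ν)`, `(x,ν,μ)` in `S y`.  `C·κ·c` = `C·c`.  The consumer's background
`U₀ = U^{(n+1)}_{k,Z}` and the j-lattice fields `V_j`, `V_Z^{(j)}` are not identified (different objects in print).
[cite: Balaban1989LargeFieldI, (1.44)–(1.48) p.186, (1.27) p.183; Balaban1985Variational, (190) p.308] -/
theorem ineq148_of_ineq190_layer
    (boxB : gB.Site → Finset X) (blkB : X → gB.Site) (pt : X → B7Prop1Explicit.Site d) (dir : X → Fin d)
    (box : gB.Site → Finset (B7Prop1Explicit.Site d)) (blk : B7Prop1Explicit.Site d → gB.Site)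
    (y₀ : gB.Site) (S : gB.Site → Finset (B7Prop1Explicit.Site d × Fin d × Fin d))
    {T : Type*} {dH : T → (X → 𝔸) →ₗ[ℝ] (B7Prop1Explicit.Site d → Fin d → 𝔸)} {C δ₀ σ τ c δ'j dist : ℝ}
    {η Lpow : ℝ} {U₀ : B7Prop1Explicit.Site d → Fin d → 𝔸ˣ}
    (h190₀ : ∀ t, Ineq190 (supSize (X := X) (E := 𝔸) gB boxB blkB)
      (supSize (X := B7Prop1Explicit.Site d) (E := Fin d → 𝔸) gB box blk) (dH t) C δ₀)
    (h190₁ : ∀ t, Ineq190 (supSize (X := X) (E := 𝔸) gB boxB blkB)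
      (ofSeminorms gB y₀ (fun y => (Lpow * η).toNNReal • covDerivSize (S y) η U₀)) (dH t) C δ₀)
    (hC : 0 ≤ C) (hdist : ∀ a b : gB.Site, 0 ≤ gB.dist a b) (hrow : RowSum gB σ c) (hτ : 0 ≤ τ) (hστ : σ + τ ≤ δ₀ / 8)
    (y : gB.Site)
    -- the (1.44) argument field on the top bonds of `Ω^c_{j+1}∖Z″_{j+1}`: (1.27), `2δ′_j ≤ ½`
    (A V : B7Prop1Explicit.Site d → Fin d → 𝔸ˣ) (hδ'j : 0 ≤ δ'j) (hδ2 : 2 * δ'j ≤ 1 / 2) (lo hi : B7Prop1Explicit.Site d)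
    (h127 : ∀ x ν, lo ≤ x → x + e ν ≤ hi → ‖((V x ν * (A x ν)⁻¹ : 𝔸ˣ) : 𝔸) - 1‖ < 2 * δ'j)
    (hX : ∀ i, lo ≤ pt i ∧ pt i + e (dir i) ≤ hi)
    -- localisation, now geometry
    (hfar : ∀ y' i, i ∈ boxB y' → dist ≤ gB.dist y y')
    -- the consumer side ((1.46)/(1.48) for the plaquette `p_{μν}(x) ∈ B^i(y)`)
    (hη : 0 < η) (h₀ : ∀ z κ, U₀ z κ ∈ U1 𝔸)
    {H : B7Prop1Explicit.Site d → Fin d → 𝔸} (hH : ∀ z κ, IsSelfAdjoint (H z κ))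
    {g : B7Prop1Explicit.Site d → 𝔸ˣ} (hg : ∀ z, g z ∈ U1 𝔸) (μ ν : Fin d) (x : B7Prop1Explicit.Site d)
    {β₀ εi εj Linv γ gj A₀ A₁ M M₁ α β : ℝ} {i j p₀ p₁ : ℕ}
    (hmv₀ : ∀ s : ℝ, (∀ t, (supSize (X := B7Prop1Explicit.Site d) (E := Fin d → 𝔸) gB box blk).loc y (dH t
        (fun i => mlog (((V (pt i) (dir i) * (A (pt i) (dir i))⁻¹ : 𝔸ˣ) : 𝔸)))) ≤ s) →
      (supSize (X := B7Prop1Explicit.Site d) (E := Fin d → 𝔸) gB box blk).loc y ((Lpow * η) • H) ≤ s)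
    (hmv₁ : ∀ s : ℝ, (∀ t, (ofSeminorms gB y₀ (fun y => (Lpow * η).toNNReal • covDerivSize (S y) η U₀)).loc y (dH t
        (fun i => mlog (((V (pt i) (dir i) * (A (pt i) (dir i))⁻¹ : 𝔸ˣ) : 𝔸)))) ≤ s) →
      (ofSeminorms gB y₀ (fun y => (Lpow * η).toNNReal • covDerivSize (S y) η U₀)).loc y ((Lpow * η) • H) ≤ s)
    -- the output dictionaries, now set geometry
    (hx : x ∈ box y) (hxμ : x + e μ ∈ box y) (hxν : x + e ν ∈ box y)
    (hS₁ : (x, μ, ν) ∈ S y) (hS₂ : (x, ν, μ) ∈ S y)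
    -- p29's located inputs and the letters
    (hL : Lpow * Linv = 1) (hLinv : 0 ≤ Linv) (hLinv1 : Linv ≤ 1) (hc : 0 ≤ c)
    (hdist0 : 0 ≤ τ * dist) (hsmallγ : 128 * (C * c) * (A₁ * (4 * (p₁ : ℝ)) ^ p₁ * Real.sqrt γ) ≤ 1)
    (hflow : εj ≤ (1 + β₀) * (1 + ((j - i : ℕ) : ℝ) ^ (1 / 2 : ℝ)) * εi) (hεi : 0 ≤ εi)
    (hA₀ : 0 < A₀) (hA₁ : 0 ≤ A₁) (hβ₀ : 0 ≤ 1 + β₀)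
    (hδ' : δ'j = gj * A₁ * logPow p₁ gj) (hεj : εj = gj * A₀ * logPow p₀ gj)
    -- (1.47): the printed distance input and `δ(M/M₁) ≥ 2`
    (hgeo : i < j → M / M₁ * ((j - i : ℕ) : ℝ) ≤ dist) (hM : 2 ≤ τ * (M / M₁))
    -- the αβ-majorisations from γ
    (hp : p₁ < p₀) (hgj : 0 < gj) (hgjγ : gj ≤ γ) (hγe : 1 ≤ Real.log (γ ^ 2)⁻¹)
    (hγ₁ : 9 * (C * c) * (A₁ / A₀) * (Real.log (γ ^ 2)⁻¹)⁻¹ * (1 + β₀) ≤ α * β)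
    (hδ'γ : δ'j ≤ A₁ * (4 * (p₁ : ℝ)) ^ p₁ * Real.sqrt γ)
    (hγ₂ : 8 * (C * c) * (A₁ * (4 * (p₁ : ℝ)) ^ p₁ * Real.sqrt γ) ≤ α * β) :
    B15.BasicStep.Ineq148 ‖B8Ineq132.plaqF (gaugeAct g (B8Lemma1NonAbelian.mulCfg (B8Eq146AExpansion.expCfg
        (B8Eq146AExpansion.iEta η H)) U₀)) μ ν x - 1‖ ‖B8Ineq132.plaqF U₀ μ ν x - 1‖
      α β ((1 / 2 : ℝ) ^ (j - i)) (εi * Linv ^ 2) := by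
  -- the weight `L^iη > 0` (`Lpow·Linv = 1`, `Linv ≥ 0`)
  have hLpow : 0 < Lpow := by
    rcases hLinv.eq_or_lt with h0 | hpos
    · exfalso
      rw [← h0, mul_zero] at hL
      exact zero_ne_one hL
    · nlinarith [hL]
  have hw : 0 ≤ Lpow * η := (mul_pos hLpow hη).le
  have hκ : C * (supSize (X := X) (E := 𝔸) gB boxB blkB).κ * c = C * c := by rw [supSize_κ, mul_one]
  exact ineq148_lattice_of_ineq190_gamma' h190₀ h190₁ hC hdist hrow hτ hστ _
    (loc_top_le boxB blkB pt dir A V hδ'j hδ2 lo hi h127 hX) y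
    (fun y' hne => by obtain ⟨i, hi, -⟩ := exists_ne_zero_of_loc_ne_zero hne; exact hfar y' i hi)
    hmv₀ hmv₁ hη h₀ hH hg μ ν x
    (weighted_sup_dict hw hx H μ) (weighted_sup_dict hw hxμ H ν) (weighted_sup_dict hw hxν H μ)
    (weighted_sup_dict hw hx H ν) (weighted_cov_dict hw hS₁ H) (weighted_cov_dict hw hS₂ H)
    hL hLinv hLinv1 hc hδ'j hdist0 (by rw [hκ]; exact hsmallγ) hflow hεi hA₀ hA₁ hβ₀ hδ' hεj hgeo hM hp hgj hgjγ hγe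
    (by rw [hκ]; exact hγ₁) hδ'γ (by rw [hκ]; exact hγ₂)

end Weighted

/-! ## §6 (v1.1) (1.56)–(1.58) ⇒ the second expression of (1.54): the (1.56) argument field (`44d²B₃ε_k`, `loc_layer156_le`), WEIGHTED
sup output size `(L^{j+1}η)·sup|ℍ|` -/

section Eq154

variable {gB : B6.Geometry} {X : Type}
variable {𝔸 : Type} [NormedRing 𝔸] [NormedAlgebra ℂ 𝔸] [CompleteSpace 𝔸] [NormOneClass 𝔸]

omit [CompleteSpace 𝔸] [NormOneClass 𝔸] in
/-- The inversely weighted function-size dictionary (as `inv_weighted_sup_dict`, normed-algebra carrier). [folklore] -/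
private theorem inv_weighted_sup_dict' {box : gB.Site → Finset (B7Prop1Explicit.Site d)} {blk : B7Prop1Explicit.Site d → gB.Site}
    {w : ℝ} (hw : 0 < w) {y : gB.Site} {x : B7Prop1Explicit.Site d} (hx : x ∈ box y)
    (H : B7Prop1Explicit.Site d → Fin d → 𝔸) (μ : Fin d) :
    ‖H x μ‖ ≤ w * (supSize (X := B7Prop1Explicit.Site d) (E := Fin d → 𝔸) gB box blk).loc y (w⁻¹ • H) := by
  have h := norm_apply_apply_le_loc (box := box) (blk := blk) hx (w⁻¹ • H) μ
  rw [Pi.smul_apply, Pi.smul_apply, norm_smul, Real.norm_eq_abs, abs_of_nonneg (inv_nonneg.mpr hw.le)] at h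
  have h2 := mul_le_mul_of_nonneg_left h hw.le
  rwa [← mul_assoc, mul_inv_cancel₀ hw.ne', one_mul] at h2

/-- **(1.57)–(1.58) ⇒ «the second expression on the right-hand side [of (1.54)] is much smaller than δ′_j», ON THE LATTICE MODEL,
FROM [15] (190) AND γ, ALL SIZES CONCRETE** — `B15Ineq154From190.second154_lt_lattice_of_ineq190_gamma'` at the INPUT size `bB :=
supSize gB boxB blkB` on the bond index set `X` of p29's (1.56) tower (`k` levels, fine field `U = U_k^{(n+1)}`, `V_k = M^k(U)` by the
constraints; `B i = log[M^{k−dep i}(U)(b_i)((Q^{s*}_{dep i}M^k(U))(b_i))⁻¹]`, p. 188 *"The field in the argument of the function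
ℍ^{(n+1)}_{k,Z} has a support in the boundary layer of the width 2M₁ at the boundary of Z, and is bounded by 44d²B₃ε_k."*): `hm` DISCHARGED by
`B15LayerSupSize.loc_layer156_le` (plaquette bound `2B₃ε_kη²` on the finest cube only), `hD` ↦ `hfar` (every block whose box carries a
bond of the field is `≥ D` from `y`; the ten-layers geometry `δ10M(R_{j+1}+⋯+R_{k−1}) + δMR_k ≤ τD` stays the printed hypothesis
`hgeom`), `κ = 1`; OUTPUT size with print's weight (1.57) `(L^{j+1}η) = (L^{k−j−1})⁻¹`: `bout := supSize gB box blk` at the rescaled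
function `ℍB := (L^{k−j−1})⁻¹ • ℍ`, the dictionary `hdom` (against `s = L^{k−j−1}·bout.loc y ℍB`) REPLACED by `hbox`.  The tower's fine
field `U` and the consumer's background `U₀ = U^{(n+1)}_{k,Z}` are NOT identified; `Lr := L`.
[cite: Balaban1989LargeFieldI, (1.54) p.187, (1.56)–(1.58) p.188; Balaban1985Variational, (190) p.308] -/
theorem second154_lt_of_ineq190_layer
    (boxB : gB.Site → Finset X) (blkB : X → gB.Site) (dep : X → ℕ) (pt : X → B7Prop1Explicit.Site d) (dir : X → Fin d)
    (box : gB.Site → Finset (B7Prop1Explicit.Site d)) (blk : B7Prop1Explicit.Site d → gB.Site)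
    {T : Type*} {dH : T → (X → 𝔸) →ₗ[ℝ] (B7Prop1Explicit.Site d → Fin d → 𝔸)}
    {C δ₀ σ τ c D B₃ δ M εk εj β₀ γ gj A₀ A₁ : ℝ} {R : ℕ → ℝ} {j k Rn r p₀ p₁ : ℕ}
    (h190 : ∀ t, Ineq190 (supSize (X := X) (E := 𝔸) gB boxB blkB)
      (supSize (X := B7Prop1Explicit.Site d) (E := Fin d → 𝔸) gB box blk) (dH t) C δ₀)
    (hC : 0 ≤ C) (hdist : ∀ a b : gB.Site, 0 ≤ gB.dist a b) (hrow : RowSum gB σ c) (hτ : 0 ≤ τ) (hστ : σ + τ ≤ δ₀ / 8)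
    (y : gB.Site)
    -- the (1.56) tower of p29 (`loc_layer156_le`): fine field `U = U_k^{(n+1)}`, `k` levels
    {L : ℕ} (hL : 2 ≤ L) (hd1 : 1 ≤ d) {G : Subgroup 𝔸ˣ} (hG : AvgClosed d L G)
    (U : B7Prop1Explicit.Site d → Fin d → 𝔸ˣ) (hU : ∀ x κ, U x κ ∈ G) (hB₃ : 0 < B₃) (hεk : 0 < εk)
    (hs3 : C0 d * (2 * B₃ * εk) ≤ 1 / 3) (hs2 : 2 * (2 * B₃ * εk) ≤ c2' d L)
    (hs : 11 * (d : ℝ) ^ 2 * (2 * B₃ * εk) ≤ 1 / 6) (lo hi : B7Prop1Explicit.Site d) (hlohi : lo ≤ hi)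
    (h156 : pdevOn (tlo L lo k) (thi L hi k) U < 2 * B₃ * εk * (((L : ℝ) ^ k)⁻¹) ^ 2)
    (h15 : ∀ n, n < k → ∀ z, tlo L lo n ≤ z → z ≤ thi L hi n → ∀ r : Fin d → Fin L,
      axialFn (avgIter L U (k - (n + 1))) ((L : ℤ) • z) ((L : ℤ) • z + boxVec L r) = 1)
    (hX : ∀ i, dep i ≤ k ∧ tlo L lo (dep i) ≤ pt i ∧ pt i + e (dir i) ≤ thi L hi (dep i))
    (hfar : ∀ y' i, i ∈ boxB y' → D ≤ gB.dist y y')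
    -- the consumer side (p29's `ineq137_local` at scale `j`, background `U₀ = U^{(n+1)}_{k,Z}`)
    {U₀ : B7Prop1Explicit.Site d → Fin d → 𝔸ˣ} (hU₀ : ∀ x κ, U₀ x κ ∈ G) {α₀ : ℝ} (hα : 0 < α₀)
    (hα3 : C0 d * α₀ ≤ 1 / 3) (hα4 : 4 * α₀ ≤ c2' d L) (h52 : pdev U₀ < α₀ * (((L : ℝ) ^ j)⁻¹) ^ 2)
    (H : B7Prop1Explicit.Site d → Fin d → 𝔸) (q : B7Prop1Explicit.Site d) (κ : Fin d)
    (hmv : ∀ s : ℝ, (∀ t, (supSize (X := B7Prop1Explicit.Site d) (E := Fin d → 𝔸) gB box blk).loc y (dH t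
        (fun i => mlog (((avgIter L U (k - dep i) (pt i) (dir i) *
          (pullIter L (avgIter L U k) (dep i) (pt i) (dir i))⁻¹ : 𝔸ˣ) : 𝔸)))) ≤ s) →
      (supSize (X := B7Prop1Explicit.Site d) (E := Fin d → 𝔸) gB box blk).loc y ((((L : ℝ) ^ (k - j - 1))⁻¹) • H) ≤ s)
    (hgeom : δ * 10 * M * (∑ l ∈ Finset.Ico (j + 1) k, R l) + δ * M * R k ≤ τ * D) (hCB : C * c ≤ B₃)
    (hjk : j < k) (hδM : (L : ℝ) + 1 ≤ δ * M) (hR1 : ∀ l, 1 ≤ R l)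
    (hstep : ∀ l, j ≤ l → l < k → R l ≤ (L : ℝ) * R (l + 1)) (hεkflow : εk ≤ (1 + β₀) * Real.sqrt ((k : ℝ) - j) * εj)
    (hεj : 0 < εj) (hβ₀ : 0 ≤ β₀)
    (hbox : ∀ y', B7Prop1Local.InBox (B7Prop1Local.loK L j q) (B7Prop1Local.bondHiK L j q κ) y' → y' ∈ box y) (hL1 : 1 ≤ L)
    -- γ data and the p. 183 / [III] (2.4) letters
    (hRj : R j = (Rn : ℝ)) (hr : 1 ≤ r) (hp : p₁ ≤ p₀) (hRn : B14.IsRj L r gj Rn) (hgj : 0 < gj) (hgjγ : gj ≤ γ)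
    (hγe : 1 ≤ Real.log (γ ^ 2)⁻¹) (hA₀ : 0 ≤ A₀) (hεjdef : εj = gj * p0Profile A₀ p₀ gj)
    (hγ : (136 * ((d : ℝ) + 1) + 320 * d) * (44 * (d : ℝ) ^ 2 * B₃ ^ 2 * (1 + β₀)) * A₀
      * (2 * ((p₀ - p₁ : ℕ) : ℝ)) ^ (p₀ - p₁) * γ < A₁)
    -- the located conditions in γ/α₀ form
    (hεj1 : εj ≤ 1)
    (hsmγ : 2048 * (d : ℝ) * (44 * (d : ℝ) ^ 2 * B₃ ^ 2 * (1 + β₀) * γ ^ 2) ≤ 1)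
    (hc₃γ : 2 * (44 * (d : ℝ) ^ 2 * B₃ ^ 2 * (1 + β₀) * γ ^ 2) ≤ c3 d L)
    (hsmallγ : Real.exp (4 * (800 * ((d : ℝ) + 1) ^ 2 * ((d : ℝ) + 4)) * α₀)
      * (1 + 8 * (131072 * ((d : ℝ) + 1) ^ 2) * (44 * (d : ℝ) ^ 2 * B₃ ^ 2 * (1 + β₀) * γ ^ 2)) ≤ 2) :
    ‖((avgIter L
          (gaugeAct (B7Eq84Concrete.glev L hL1 U₀
              (expCfg (fun y μ => ((Complex.I : ℂ) * ((((L : ℝ) ^ j)⁻¹ : ℝ) : ℂ)) • H y μ)) j 0)⁻¹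
            (expCfg (fun y μ => ((Complex.I : ℂ) * ((((L : ℝ) ^ j)⁻¹ : ℝ) : ℂ)) • H y μ) * U₀)) j q κ : 𝔸ˣ) : 𝔸)
        * (((avgIter L U₀ j q κ)⁻¹ : 𝔸ˣ) : 𝔸) - 1‖ < gj * p0Profile A₁ p₁ gj := by
  have hLr : (2 : ℝ) ≤ (L : ℝ) := by exact_mod_cast hL
  have hLpos : (0 : ℝ) < L := by linarith
  have hw : (0 : ℝ) < (L : ℝ) ^ (k - j - 1) := pow_pos hLpos _
  have hdpos : 0 < d := hd1
  exact second154_lt_lattice_of_ineq190_gamma' h190 hC hdist hrow hτ hστ _ y hL hG hU₀ hα hα3 hα4 h52 H q κ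
    (loc_layer156_le boxB blkB dep pt dir L hL hd1 hG k U hU hB₃ hεk hs3 hs2 hs lo hi hlohi h156 h15 hX)
    (fun y' hne => by obtain ⟨i, hi, -⟩ := exists_ne_zero_of_loc_ne_zero hne; exact hfar y' i hi)
    hmv hgeom (by rw [supSize_κ, mul_one]; exact hCB) hjk hLr hδM hR1 hstep hεkflow hεk.le hεj hβ₀ hB₃ hdpos
    (fun y' μ hy => inv_weighted_sup_dict' hw (hbox y' hy) H μ) hL1 hRj hr hp hRn hgj hgjγ hγe hA₀ hεjdef hγ hd1 hεj1 hsmγ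
    hc₃γ hsmallγ

end Eq154

/-! ## §7 (v1.2) (1.90) ⇒ (1.91) with the tower's fine field `W` FREE (print: the tower of the represented field `U″_{k,Z}`) -/

section Eq191W

variable {gB : B6.Geometry} {X : Type}
variable {𝔸 : Type} [CStarAlgebra 𝔸] [Nontrivial 𝔸]

/-- **(1.90) ⇒ (1.91) ON THE LATTICE, FROM [15] (190) AND γ, ALL SIZES CONCRETE, the tower's fine field FREE (two-sup reading,
`α ↦ 2α`)** — as `ineq191_twoSup_of_ineq190_layer` (§4) but the (1.90) argument field `B i = log[M^{K−dep i}(W)(b_i)((Q^{s*}_{dep i}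
M^K(W))(b_i))⁻¹]` is that of the tower of a SEPARATE lattice field `W` — print: `W = U″_{k,Z}`, the REPRESENTED field of (1.90)
(*"U″_{k,Z} = U(𝔹_h(□^{∼4}), [M˙(U″_{k,Z})(M˙(Q_h^{s*}V″))⁻¹]M˙(Q_h^{s*}V″)) = (exp iL^{k−h}ηℍ_{h,□}((1/i)log[…]) U_{h,□}(V″))^{u⁻¹_{h,□}}"*,
`V″` its top constraint) —, NOT identified with the consumer's background `U₀` (print: `U_{h,□}(V″)`, whose plaquette deviation is the
`dev₀` of `Ineq191`) nor with the consumer's represented field `(e^{iξℍ}U₀)^{g}`; `hm` (*"can be bounded … 11d²ε_h"*) DISCHARGED by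
`B15LayerSupSize.loc_layer190_le` from p29's located input `h190p` (plaquette bound `½ε_h(L^K)⁻²` of `W` on the finest cube — see the
READING NOTE of the module docstring, GAPS G-B15-r12-09), `hD` ↦ `hfar`, `κ = 1`; OUTPUT sizes `bout₀ := supSize gB box blk`, `bout₁ :=
covDerivBlockSize gB y₀ S ξ U₀`, `ℍB := ℍ`: the six dictionary hypotheses REPLACED by membership.  §4 is the special case `W = U₀`.
[cite: Balaban1989LargeFieldI, (1.90)–(1.91) p.198; Balaban1985Variational, (190) p.308] -/
theorem ineq191_twoSup_of_ineq190_layerW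
    (boxB : gB.Site → Finset X) (blkB : X → gB.Site) (dep : X → ℕ) (pt : X → B7Prop1Explicit.Site d) (dir : X → Fin d)
    (box : gB.Site → Finset (B7Prop1Explicit.Site d)) (blk : B7Prop1Explicit.Site d → gB.Site)
    (y₀ : gB.Site) (S : gB.Site → Finset (B7Prop1Explicit.Site d × Fin d × Fin d))
    {T : Type*} {dH : T → (X → 𝔸) →ₗ[ℝ] (B7Prop1Explicit.Site d → Fin d → 𝔸)}
    {C δ₀ σ τ c D B₃ δ M₂ εh γ gh α : ℝ} {r R : ℕ}
    {ξ : ℝ} {L : ℕ} {K : ℕ} {U₀ : B7Prop1Explicit.Site d → Fin d → 𝔸ˣ}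
    (h190₀ : ∀ t, Ineq190 (supSize (X := X) (E := 𝔸) gB boxB blkB)
      (supSize (X := B7Prop1Explicit.Site d) (E := Fin d → 𝔸) gB box blk) (dH t) C δ₀)
    (h190₁ : ∀ t, Ineq190 (supSize (X := X) (E := 𝔸) gB boxB blkB) (covDerivBlockSize gB y₀ S ξ U₀) (dH t) C δ₀)
    (hC : 0 ≤ C) (hdist : ∀ a b : gB.Site, 0 ≤ gB.dist a b) (hrow : RowSum gB σ c) (hτ : 0 ≤ τ) (hστ : σ + τ ≤ δ₀ / 8)
    (y : gB.Site)
    -- the (1.90) tower of p29 (`loc_layer190_le`): fine field `W` (print: `U″_{k,Z}`), `K` levels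
    (hL : 2 ≤ L) (hd1 : 1 ≤ d) {G : Subgroup 𝔸ˣ} (hG : AvgClosed d L G)
    (W : B7Prop1Explicit.Site d → Fin d → 𝔸ˣ) (hW : ∀ x κ, W x κ ∈ G) (hε : 0 < εh)
    (hs3 : C0 d * (εh * (1 / 2)) ≤ 1 / 3) (hs2 : 2 * (εh * (1 / 2)) ≤ c2' d L)
    (hs : 11 * (d : ℝ) ^ 2 * (εh * (1 / 2)) ≤ 1 / 6) (lo hi : B7Prop1Explicit.Site d) (hlohi : lo ≤ hi)
    (h190p : pdevOn (tlo L lo K) (thi L hi K) W < εh * (1 / 2) * (((L : ℝ) ^ K)⁻¹) ^ 2)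
    (h15 : ∀ n, n < K → ∀ z, tlo L lo n ≤ z → z ≤ thi L hi n → ∀ r : Fin d → Fin L,
      axialFn (avgIter L W (K - (n + 1))) ((L : ℤ) • z) ((L : ℤ) • z + boxVec L r) = 1)
    (hX : ∀ i, dep i ≤ K ∧ tlo L lo (dep i) ≤ pt i ∧ pt i + e (dir i) ≤ thi L hi (dep i))
    (hfar : ∀ y' i, i ∈ boxB y' → D ≤ gB.dist y y')
    -- the consumer side ((1.91) for the plaquette `p_{μν}(x)`; background `U₀` = print's `U_{h,□}(V″)`)
    (hξ : 0 < ξ) (h₀ : ∀ z κ, U₀ z κ ∈ U1 𝔸) {H : B7Prop1Explicit.Site d → Fin d → 𝔸} (hH : ∀ z κ, IsSelfAdjoint (H z κ))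
    {g : B7Prop1Explicit.Site d → 𝔸ˣ} (hg : ∀ z, g z ∈ U1 𝔸) (μ ν : Fin d) (x : B7Prop1Explicit.Site d) {Linv : ℝ}
    (hmv₀ : ∀ s : ℝ, (∀ t, (supSize (X := B7Prop1Explicit.Site d) (E := Fin d → 𝔸) gB box blk).loc y (dH t
        (fun i => mlog (((avgIter L W (K - dep i) (pt i) (dir i) *
          (pullIter L (avgIter L W K) (dep i) (pt i) (dir i))⁻¹ : 𝔸ˣ) : 𝔸)))) ≤ s) →
      (supSize (X := B7Prop1Explicit.Site d) (E := Fin d → 𝔸) gB box blk).loc y H ≤ s)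
    (hmv₁ : ∀ s : ℝ, (∀ t, (covDerivBlockSize gB y₀ S ξ U₀).loc y (dH t
        (fun i => mlog (((avgIter L W (K - dep i) (pt i) (dir i) *
          (pullIter L (avgIter L W K) (dep i) (pt i) (dir i))⁻¹ : 𝔸ˣ) : 𝔸)))) ≤ s) →
      (covDerivBlockSize gB y₀ S ξ U₀).loc y H ≤ s)
    (hgeom : δ * 2 * L * M₂ * R ≤ τ * D) (hCB : C * c ≤ B₃) (hB₃ : 0 < B₃)
    -- γ data
    (hr : 1 ≤ r) (hR : B14.IsRj L r gh R) (hgh : 0 < gh) (hgγ : gh ≤ γ) (hγe : 1 ≤ Real.log (γ ^ 2)⁻¹)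
    (hc1 : 1 < δ * 2 * L * M₂) (hRh : 0 < (R : ℝ)) (hγ : 11 * (d : ℝ) ^ 2 * B₃ * γ ^ 2 < α)
    -- the output dictionaries, now set geometry
    (hx : x ∈ box y) (hxμ : x + e μ ∈ box y) (hxν : x + e ν ∈ box y)
    (hS₁ : (x, μ, ν) ∈ S y) (hS₂ : (x, ν, μ) ∈ S y) (hLinv : 0 ≤ Linv) :
    B15.PrelimIntegrations.Ineq191 ‖B8Ineq132.plaqF (gaugeAct g (B8Lemma1NonAbelian.mulCfg (B8Eq146AExpansion.expCfg
        (B8Eq146AExpansion.iEta ξ H)) U₀)) μ ν x - 1‖ ‖B8Ineq132.plaqF U₀ μ ν x - 1‖ (2 * α) Linv εh (εh * ξ ^ 2) := by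
  have hdpos : 0 < d := hd1
  exact ineq191_lattice_twoSup_of_ineq190_gamma h190₀ h190₁ hC hdist hrow hτ hστ _ y hξ h₀ hH hg μ ν x
    (loc_layer190_le boxB blkB dep pt dir L hL hd1 hG K W hW hε hs3 hs2 hs lo hi hlohi h190p h15 hX)
    (fun y' hne => by obtain ⟨i, hi, -⟩ := exists_ne_zero_of_loc_ne_zero hne; exact hfar y' i hi)
    hmv₀ hmv₁ hgeom (by rw [supSize_κ, mul_one]; exact hCB) hB₃ hr hR hgh hgγ hγe hc1 hRh hdpos hε hγ
    (norm_apply_apply_le_loc hx H μ) (norm_apply_apply_le_loc hxμ H ν) (norm_apply_apply_le_loc hxν H μ)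
    (norm_apply_apply_le_loc hx H ν) (norm_covDerivFwd_le_loc hS₁ H) (norm_covDerivFwd_le_loc hS₂ H) hLinv

end Eq191W

/-! ## §8 (v1.2) (1.96): chain 1 (= (1.90)/(1.91)) from (190) + γ with all sizes concrete, chain 2 (= (1.93)–(1.95)) through the
printed bound (1.94) -/

section Eq196

variable {gB : B6.Geometry} {X : Type}
variable {𝔸 : Type} [CStarAlgebra 𝔸] [Nontrivial 𝔸]

/-- **(1.96) p. 199 ON THE LATTICE, chain 1 FROM [15] (190) AND γ WITH ALL SIZES CONCRETE, chain 2 FROM THE PRINTED (1.94)** —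
pp. 198–199, verbatim: *"From the representation (1.93) and the above bounds we get [(1.95)]. The estimates (1.91), (1.95) yield
|U″_{k,Z}(∂p) − 1| < ¾ε_h(L^{k−h}η)² < (1 − β(1 − 2^{−(k−h+1)}))ε_h(L^{k−h}η)² (1.96) for p ⊂ □^∼"* (v1.4: restored verbatim; v1.3 had here
the unprinted paraphrase «The fields in the exponential transformations (1.92), (1.93) … the restriction introduced by χ_{h,1/2} yield …»,
QUOTE-AUDIT-B15 A5): r12's `B15Ineq191Lattice.ineq196_lattice_twoSup` (two-sup reading; print's `α = 1/12` = `2·(1/24)`) with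
CHAIN 1 — `ℍ₁ = ℍ_{h,□}` of the representation (1.90) of `U″_{k,Z} = (e^{iξℍ₁}Uhb)^{g₁}` over the background `Uhb := U_{h,□}(V″)` — fed
as in §7: INPUT size `bB := supSize gB boxB blkB` on the index set `X` of the (1.90) tower of a free fine field `W` (print: `U″_{k,Z}`),
`hm` (*"11d²ε_h"*) by `B15LayerSupSize.loc_layer190_le` from `h190p`, `hD` ↦ `hfar`, mean-value domination `hmv₀`/`hmv₁`, (190) for
the two OUTPUT sizes `supSize gB box blk` / `covDerivBlockSize gB y₀ S ξ Uhb` (covariant derivative at chain 1's background), the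
six dictionary hypotheses ↦ membership, members 2–3 of (1.90) from γ (`boundH190_lt_alpha_of_gamma`, clause `11d²B₃γ² < 1/24`);
CHAIN 2 — `ℍ₂ = ℍ_{h,□}` of the representation (1.93) of `Uhb = U_{h,□}(V″) = (e^{iξℍ₂}U₁)^{g₂}` over `U₁ := U_{h,□}((1,V_h))` — entering
EXACTLY through the printed bound (1.94) *"|ℍ_{h,□}|, |∇ℍ_{h,□}| … < αε_h"* (`hB₁`–`hB₄`, `hBD₁`, `hBD₂`, `hY₂ : Y₂ < (1/24)ε_h`;
row B15.Eq1.94, proved along the flow in `B15Ineq194Last`); the `χ_{h,1/2}`-restriction (1.88) `hhalf` on `U₁`, `β ≤ ¼` (p. 198),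
`0 < ε_h ≤ 1/10`, `t = 2^{−(k−h+1)} ∈ (0,1]`, `0 ≤ L^{−h} ≤ 1` as located in `ineq196_lattice`.
[cite: Balaban1989LargeFieldI, (1.90)–(1.96) pp.198–199; Balaban1985Variational, (190) p.308] -/
theorem ineq196_twoSup_of_ineq190_layer
    (boxB : gB.Site → Finset X) (blkB : X → gB.Site) (dep : X → ℕ) (pt : X → B7Prop1Explicit.Site d) (dir : X → Fin d)
    (box : gB.Site → Finset (B7Prop1Explicit.Site d)) (blk : B7Prop1Explicit.Site d → gB.Site)
    (y₀ : gB.Site) (S : gB.Site → Finset (B7Prop1Explicit.Site d × Fin d × Fin d))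
    {T : Type*} {dH : T → (X → 𝔸) →ₗ[ℝ] (B7Prop1Explicit.Site d → Fin d → 𝔸)}
    {C δ₀ σ τ c D B₃ δ M₂ εh γ gh : ℝ} {r R : ℕ}
    {ξ : ℝ} {L : ℕ} {K : ℕ} {Uhb : B7Prop1Explicit.Site d → Fin d → 𝔸ˣ}
    (h190₀ : ∀ t, Ineq190 (supSize (X := X) (E := 𝔸) gB boxB blkB)
      (supSize (X := B7Prop1Explicit.Site d) (E := Fin d → 𝔸) gB box blk) (dH t) C δ₀)
    (h190₁ : ∀ t, Ineq190 (supSize (X := X) (E := 𝔸) gB boxB blkB) (covDerivBlockSize gB y₀ S ξ Uhb) (dH t) C δ₀)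
    (hC : 0 ≤ C) (hdist : ∀ a b : gB.Site, 0 ≤ gB.dist a b) (hrow : RowSum gB σ c) (hτ : 0 ≤ τ) (hστ : σ + τ ≤ δ₀ / 8)
    (y : gB.Site)
    -- chain 1's argument field: the (1.90) tower of `W` (print: `U″_{k,Z}`), `K` levels (p29 `loc_layer190_le`)
    (hL : 2 ≤ L) (hd1 : 1 ≤ d) {G : Subgroup 𝔸ˣ} (hG : AvgClosed d L G)
    (W : B7Prop1Explicit.Site d → Fin d → 𝔸ˣ) (hW : ∀ x κ, W x κ ∈ G) (hε : 0 < εh)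
    (hs3 : C0 d * (εh * (1 / 2)) ≤ 1 / 3) (hs2 : 2 * (εh * (1 / 2)) ≤ c2' d L)
    (hs : 11 * (d : ℝ) ^ 2 * (εh * (1 / 2)) ≤ 1 / 6) (lo hi : B7Prop1Explicit.Site d) (hlohi : lo ≤ hi)
    (h190p : pdevOn (tlo L lo K) (thi L hi K) W < εh * (1 / 2) * (((L : ℝ) ^ K)⁻¹) ^ 2)
    (h15 : ∀ n, n < K → ∀ z, tlo L lo n ≤ z → z ≤ thi L hi n → ∀ r : Fin d → Fin L,
      axialFn (avgIter L W (K - (n + 1))) ((L : ℤ) • z) ((L : ℤ) • z + boxVec L r) = 1)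
    (hX : ∀ i, dep i ≤ K ∧ tlo L lo (dep i) ≤ pt i ∧ pt i + e (dir i) ≤ thi L hi (dep i))
    (hfar : ∀ y' i, i ∈ boxB y' → D ≤ gB.dist y y')
    -- the lattice data of (1.90)/(1.93): `U″_{k,Z} = (e^{iξℍ₁}Uhb)^{g₁}`, `Uhb = (e^{iξℍ₂}U₁)^{g₂}`
    (hξ : 0 < ξ) (hUhb : ∀ z κ, Uhb z κ ∈ U1 𝔸)
    {H₁ : B7Prop1Explicit.Site d → Fin d → 𝔸} (hH₁sa : ∀ z κ, IsSelfAdjoint (H₁ z κ))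
    {g₁ : B7Prop1Explicit.Site d → 𝔸ˣ} (hg₁ : ∀ z, g₁ z ∈ U1 𝔸)
    {U₁ : B7Prop1Explicit.Site d → Fin d → 𝔸ˣ} (hU₁ : ∀ z κ, U₁ z κ ∈ U1 𝔸)
    {H₂ : B7Prop1Explicit.Site d → Fin d → 𝔸} (hH₂sa : ∀ z κ, IsSelfAdjoint (H₂ z κ))
    {g₂ : B7Prop1Explicit.Site d → 𝔸ˣ} (hg₂ : ∀ z, g₂ z ∈ U1 𝔸)
    (hrep : Uhb = gaugeAct g₂ (B8Lemma1NonAbelian.mulCfg (B8Eq146AExpansion.expCfg (B8Eq146AExpansion.iEta ξ H₂)) U₁))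
    (μ ν : Fin d) (x : B7Prop1Explicit.Site d) {Linv Y₂ β t : ℝ}
    -- chain 1: mean-value domination of `ℍ₁` by the base-point derivatives along the segment to its argument field
    (hmv₀ : ∀ s : ℝ, (∀ t, (supSize (X := B7Prop1Explicit.Site d) (E := Fin d → 𝔸) gB box blk).loc y (dH t
        (fun i => mlog (((avgIter L W (K - dep i) (pt i) (dir i) *
          (pullIter L (avgIter L W K) (dep i) (pt i) (dir i))⁻¹ : 𝔸ˣ) : 𝔸)))) ≤ s) →
      (supSize (X := B7Prop1Explicit.Site d) (E := Fin d → 𝔸) gB box blk).loc y H₁ ≤ s)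
    (hmv₁ : ∀ s : ℝ, (∀ t, (covDerivBlockSize gB y₀ S ξ Uhb).loc y (dH t
        (fun i => mlog (((avgIter L W (K - dep i) (pt i) (dir i) *
          (pullIter L (avgIter L W K) (dep i) (pt i) (dir i))⁻¹ : 𝔸ˣ) : 𝔸)))) ≤ s) →
      (covDerivBlockSize gB y₀ S ξ Uhb).loc y H₁ ≤ s)
    (hgeom : δ * 2 * L * M₂ * R ≤ τ * D) (hCB : C * c ≤ B₃) (hB₃ : 0 < B₃)
    -- γ data with the two-sup constant `1/24` (`2·(1/24) = 1/12 = print's α`)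
    (hr : 1 ≤ r) (hR : B14.IsRj L r gh R) (hgh : 0 < gh) (hgγ : gh ≤ γ) (hγe : 1 ≤ Real.log (γ ^ 2)⁻¹)
    (hc1 : 1 < δ * 2 * L * M₂) (hRh : 0 < (R : ℝ)) (hγ : 11 * (d : ℝ) ^ 2 * B₃ * γ ^ 2 < 1 / 24)
    -- chain 1's output dictionaries, now set geometry
    (hx : x ∈ box y) (hxμ : x + e μ ∈ box y) (hxν : x + e ν ∈ box y)
    (hS₁ : (x, μ, ν) ∈ S y) (hS₂ : (x, ν, μ) ∈ S y)
    -- chain 2: the printed bound (1.94) on `ℍ₂` and its covariant derivatives at `U₁`, `< (1/24)ε_h`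
    (hB₁ : ‖H₂ x μ‖ ≤ Y₂) (hB₂ : ‖H₂ (x + e μ) ν‖ ≤ Y₂) (hB₃' : ‖H₂ (x + e ν) μ‖ ≤ Y₂) (hB₄ : ‖H₂ x ν‖ ≤ Y₂)
    (hBD₁ : ‖B8Ineq132.covDerivFwd ξ U₁ μ (fun z => H₂ z ν) x‖ ≤ Y₂)
    (hBD₂ : ‖B8Ineq132.covDerivFwd ξ U₁ ν (fun z => H₂ z μ) x‖ ≤ Y₂) (hY₂ : Y₂ < 1 / 24 * εh)
    -- the located inputs of `ineq196_lattice`: χ_{h,1/2} on `U₁`, `0 ≤ L^{−h} ≤ 1`, `ε_h ≤ 1/10`, `β ≤ ¼`, `t ∈ (0,1]`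
    (hhalf : ‖B8Ineq132.plaqF U₁ μ ν x - 1‖ < 1 / 2 * (εh * ξ ^ 2)) (hL0 : 0 ≤ Linv) (hL1 : Linv ≤ 1)
    (hε1 : εh ≤ 1 / 10) (hβ : β ≤ 1 / 4) (ht0 : 0 < t) (ht1 : t ≤ 1) :
    B15.BasicStep.Ineq196 ‖B8Ineq132.plaqF (gaugeAct g₁ (B8Lemma1NonAbelian.mulCfg (B8Eq146AExpansion.expCfg
        (B8Eq146AExpansion.iEta ξ H₁)) Uhb)) μ ν x - 1‖ β t (εh * ξ ^ 2) := by
  have hdR : (0 : ℝ) < d := by exact_mod_cast (show 0 < d from hd1)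
  have hκ : C * (supSize (X := X) (E := 𝔸) gB boxB blkB).κ * c ≤ B₃ := by rw [supSize_κ, mul_one]; exact hCB
  have hm := loc_layer190_le boxB blkB dep pt dir L hL hd1 hG K W hW hε hs3 hs2 hs lo hi hlohi h190p h15 hX
  have hD : ∀ y', (supSize (X := X) (E := 𝔸) gB boxB blkB).loc y'
      (fun i => mlog (((avgIter L W (K - dep i) (pt i) (dir i) *
        (pullIter L (avgIter L W K) (dep i) (pt i) (dir i))⁻¹ : 𝔸ˣ) : 𝔸))) ≠ 0 → D ≤ gB.dist y y' :=
    fun y' hne => by obtain ⟨i, hi, -⟩ := exists_ne_zero_of_loc_ne_zero hne; exact hfar y' i hi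
  -- chain 1 from (190): members 1–3 of (1.90) for both output sizes
  have hb₀ := B15HDecayLeaves.boundH190_of_ineq190 h190₀ hC hdist hrow hτ hστ _ y hm hD hmv₀ hgeom hκ hB₃.le hε.le
  have hb₁ := B15HDecayLeaves.boundH190_of_ineq190 h190₁ hC hdist hrow hτ hστ _ y hm hD hmv₁ hgeom hκ hB₃.le hε.le
  have hs₀ := B15GammaSmallness.boundH190_lt_alpha_of_gamma hr hb₀ hR hgh hgγ hγe hc1 hRh hB₃ hdR hε hγ
  have hs₁ := B15GammaSmallness.boundH190_lt_alpha_of_gamma hr hb₁ hR hgh hgγ hγe hc1 hRh hB₃ hdR hε hγ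
  set Y₁ := max ((supSize (X := B7Prop1Explicit.Site d) (E := Fin d → 𝔸) gB box blk).loc y H₁)
    ((covDerivBlockSize gB y₀ S ξ Uhb).loc y H₁) with hY₁
  have hY₁lt : Y₁ < 1 / 24 * εh := max_lt hs₀ hs₁
  exact B15Ineq191Lattice.ineq196_lattice_twoSup hξ hUhb hH₁sa hg₁ hU₁ hH₂sa hg₂ hrep μ ν x
    ((norm_apply_apply_le_loc hx H₁ μ).trans (le_max_left _ _))
    ((norm_apply_apply_le_loc hxμ H₁ ν).trans (le_max_left _ _))
    ((norm_apply_apply_le_loc hxν H₁ μ).trans (le_max_left _ _))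
    ((norm_apply_apply_le_loc hx H₁ ν).trans (le_max_left _ _))
    ((norm_covDerivFwd_le_loc hS₁ H₁).trans (le_max_right _ _))
    ((norm_covDerivFwd_le_loc hS₂ H₁).trans (le_max_right _ _)) hY₁lt
    hB₁ hB₂ hB₃' hB₄ hBD₁ hBD₂ hY₂ hhalf rfl hL0 hL1 hε hε1 hβ ht0 ht1

end Eq196

/-! ## §9 (v1.2) (1.96) with the mean-value domination DISCHARGED (p29 `B11MeanValue190`): `ℍ₁ = Hop B`, `Hop 0 = 0`,
differentiability of `τ ↦ Hop(τB)(z)` along the segment -/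

section Eq196MV

variable {gB : B6.Geometry} {X : Type}
variable {𝔸 : Type} [CStarAlgebra 𝔸] [Nontrivial 𝔸]

/-- **(1.96) as in §8 with `hmv₀`/`hmv₁` DISCHARGED** by p29's `B11MeanValue190.hmv_supSize_of_forall` / `hmv_covDerivBlockSize`
(index family `T := Icc 0 1`): the `ℍ`-operator of chain 1 is a map `Hop : (X → 𝔸) → (T^{(k)} → 𝔸^d)` with `Hop 0 = 0` ([15] (175):
`𝓗` is first order in `B`) such that, for the concrete argument field `B` of the tower of `W`, every value `τ ↦ Hop(τB)(z)` has the
derivative `(dH τ B)(z)` within `[0,1]` at every `τ ∈ [0,1]` ([15] Sect. G / Prop. 9's ball); `ℍ₁ := Hop B`.  What is LEFT: (190) for the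
family `dH` between the concrete sizes (= [15] Prop. 9), (2.61), this differentiability, the geometry, the located clauses.
[cite: Balaban1989LargeFieldI, (1.90)–(1.96) pp.198–199; Balaban1985Variational, (175) p.305, (190) p.308] -/
theorem ineq196_twoSup_of_ineq190_layer_mv
    (boxB : gB.Site → Finset X) (blkB : X → gB.Site) (dep : X → ℕ) (pt : X → B7Prop1Explicit.Site d) (dir : X → Fin d)
    (box : gB.Site → Finset (B7Prop1Explicit.Site d)) (blk : B7Prop1Explicit.Site d → gB.Site)
    (y₀ : gB.Site) (S : gB.Site → Finset (B7Prop1Explicit.Site d × Fin d × Fin d))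
    {dH : Set.Icc (0:ℝ) 1 → (X → 𝔸) →ₗ[ℝ] (B7Prop1Explicit.Site d → Fin d → 𝔸)}
    {C δ₀ σ τ c D B₃ δ M₂ εh γ gh : ℝ} {r R : ℕ}
    {ξ : ℝ} {L : ℕ} {K : ℕ} {Uhb : B7Prop1Explicit.Site d → Fin d → 𝔸ˣ}
    (h190₀ : ∀ t, Ineq190 (supSize (X := X) (E := 𝔸) gB boxB blkB)
      (supSize (X := B7Prop1Explicit.Site d) (E := Fin d → 𝔸) gB box blk) (dH t) C δ₀)
    (h190₁ : ∀ t, Ineq190 (supSize (X := X) (E := 𝔸) gB boxB blkB) (covDerivBlockSize gB y₀ S ξ Uhb) (dH t) C δ₀)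
    (hC : 0 ≤ C) (hdist : ∀ a b : gB.Site, 0 ≤ gB.dist a b) (hrow : RowSum gB σ c) (hτ : 0 ≤ τ) (hστ : σ + τ ≤ δ₀ / 8)
    (y : gB.Site)
    (hL : 2 ≤ L) (hd1 : 1 ≤ d) {G : Subgroup 𝔸ˣ} (hG : AvgClosed d L G)
    (W : B7Prop1Explicit.Site d → Fin d → 𝔸ˣ) (hW : ∀ x κ, W x κ ∈ G) (hε : 0 < εh)
    (hs3 : C0 d * (εh * (1 / 2)) ≤ 1 / 3) (hs2 : 2 * (εh * (1 / 2)) ≤ c2' d L)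
    (hs : 11 * (d : ℝ) ^ 2 * (εh * (1 / 2)) ≤ 1 / 6) (lo hi : B7Prop1Explicit.Site d) (hlohi : lo ≤ hi)
    (h190p : pdevOn (tlo L lo K) (thi L hi K) W < εh * (1 / 2) * (((L : ℝ) ^ K)⁻¹) ^ 2)
    (h15 : ∀ n, n < K → ∀ z, tlo L lo n ≤ z → z ≤ thi L hi n → ∀ r : Fin d → Fin L,
      axialFn (avgIter L W (K - (n + 1))) ((L : ℤ) • z) ((L : ℤ) • z + boxVec L r) = 1)
    (hX : ∀ i, dep i ≤ K ∧ tlo L lo (dep i) ≤ pt i ∧ pt i + e (dir i) ≤ thi L hi (dep i))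
    (hfar : ∀ y' i, i ∈ boxB y' → D ≤ gB.dist y y')
    (hξ : 0 < ξ) (hUhb : ∀ z κ, Uhb z κ ∈ U1 𝔸)
    -- the `ℍ`-operator of chain 1 as a function of its argument field: `Hop 0 = 0`, differentiable along the segment
    (Hop : (X → 𝔸) → B7Prop1Explicit.Site d → Fin d → 𝔸) (hHop0 : Hop 0 = 0)
    (hderiv : ∀ z, ∀ (τ : ℝ) (hτ' : τ ∈ Set.Icc (0:ℝ) 1),
      HasDerivWithinAt (fun τ' : ℝ => Hop (τ' • (fun i => mlog (((avgIter L W (K - dep i) (pt i) (dir i) *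
          (pullIter L (avgIter L W K) (dep i) (pt i) (dir i))⁻¹ : 𝔸ˣ) : 𝔸)))) z)
        (dH ⟨τ, hτ'⟩ (fun i => mlog (((avgIter L W (K - dep i) (pt i) (dir i) *
          (pullIter L (avgIter L W K) (dep i) (pt i) (dir i))⁻¹ : 𝔸ˣ) : 𝔸))) z) (Set.Icc (0:ℝ) 1) τ)
    (hH₁sa : ∀ z κ, IsSelfAdjoint (Hop (fun i => mlog (((avgIter L W (K - dep i) (pt i) (dir i) *
          (pullIter L (avgIter L W K) (dep i) (pt i) (dir i))⁻¹ : 𝔸ˣ) : 𝔸))) z κ))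
    {g₁ : B7Prop1Explicit.Site d → 𝔸ˣ} (hg₁ : ∀ z, g₁ z ∈ U1 𝔸)
    {U₁ : B7Prop1Explicit.Site d → Fin d → 𝔸ˣ} (hU₁ : ∀ z κ, U₁ z κ ∈ U1 𝔸)
    {H₂ : B7Prop1Explicit.Site d → Fin d → 𝔸} (hH₂sa : ∀ z κ, IsSelfAdjoint (H₂ z κ))
    {g₂ : B7Prop1Explicit.Site d → 𝔸ˣ} (hg₂ : ∀ z, g₂ z ∈ U1 𝔸)
    (hrep : Uhb = gaugeAct g₂ (B8Lemma1NonAbelian.mulCfg (B8Eq146AExpansion.expCfg (B8Eq146AExpansion.iEta ξ H₂)) U₁))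
    (μ ν : Fin d) (x : B7Prop1Explicit.Site d) {Linv Y₂ β t : ℝ}
    (hgeom : δ * 2 * L * M₂ * R ≤ τ * D) (hCB : C * c ≤ B₃) (hB₃ : 0 < B₃)
    (hr : 1 ≤ r) (hR : B14.IsRj L r gh R) (hgh : 0 < gh) (hgγ : gh ≤ γ) (hγe : 1 ≤ Real.log (γ ^ 2)⁻¹)
    (hc1 : 1 < δ * 2 * L * M₂) (hRh : 0 < (R : ℝ)) (hγ : 11 * (d : ℝ) ^ 2 * B₃ * γ ^ 2 < 1 / 24)
    (hx : x ∈ box y) (hxμ : x + e μ ∈ box y) (hxν : x + e ν ∈ box y)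
    (hS₁ : (x, μ, ν) ∈ S y) (hS₂ : (x, ν, μ) ∈ S y)
    (hB₁ : ‖H₂ x μ‖ ≤ Y₂) (hB₂ : ‖H₂ (x + e μ) ν‖ ≤ Y₂) (hB₃' : ‖H₂ (x + e ν) μ‖ ≤ Y₂) (hB₄ : ‖H₂ x ν‖ ≤ Y₂)
    (hBD₁ : ‖B8Ineq132.covDerivFwd ξ U₁ μ (fun z => H₂ z ν) x‖ ≤ Y₂)
    (hBD₂ : ‖B8Ineq132.covDerivFwd ξ U₁ ν (fun z => H₂ z μ) x‖ ≤ Y₂) (hY₂ : Y₂ < 1 / 24 * εh)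
    (hhalf : ‖B8Ineq132.plaqF U₁ μ ν x - 1‖ < 1 / 2 * (εh * ξ ^ 2)) (hL0 : 0 ≤ Linv) (hL1 : Linv ≤ 1)
    (hε1 : εh ≤ 1 / 10) (hβ : β ≤ 1 / 4) (ht0 : 0 < t) (ht1 : t ≤ 1) :
    B15.BasicStep.Ineq196 ‖B8Ineq132.plaqF (gaugeAct g₁ (B8Lemma1NonAbelian.mulCfg (B8Eq146AExpansion.expCfg
        (B8Eq146AExpansion.iEta ξ (Hop (fun i => mlog (((avgIter L W (K - dep i) (pt i) (dir i) *
          (pullIter L (avgIter L W K) (dep i) (pt i) (dir i))⁻¹ : 𝔸ˣ) : 𝔸)))))) Uhb)) μ ν x - 1‖ β t (εh * ξ ^ 2) := by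
  set B : X → 𝔸 := fun i => mlog (((avgIter L W (K - dep i) (pt i) (dir i) *
    (pullIter L (avgIter L W K) (dep i) (pt i) (dir i))⁻¹ : 𝔸ˣ) : 𝔸)) with hB
  have hmv₀ := B11MeanValue190.hmv_supSize_of_forall (g := gB) (box := box) (blk := blk) Hop dH B y hHop0 hderiv
  have hmv₁ := B11MeanValue190.hmv_covDerivBlockSize (g := gB) Hop dH B (y₀ := y₀) y (S := S) (ξ := ξ) (U₀ := Uhb) hHop0 hderiv
  exact ineq196_twoSup_of_ineq190_layer boxB blkB dep pt dir box blk y₀ S h190₀ h190₁ hC hdist hrow hτ hστ y hL hd1 hG W hW hε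
    hs3 hs2 hs lo hi hlohi h190p h15 hX hfar hξ hUhb hH₁sa hg₁ hU₁ hH₂sa hg₂ hrep μ ν x hmv₀ hmv₁ hgeom hCB hB₃ hr hR hgh hgγ
    hγe hc1 hRh hγ hx hxμ hxν hS₁ hS₂ hB₁ hB₂ hB₃' hB₄ hBD₁ hBD₂ hY₂ hhalf hL0 hL1 hε1 hβ ht0 ht1

end Eq196MV

/-! ## §10 (v1.3) (1.98) p. 200 with the two p. 199 `ℍ`-chains AS PRINTED: chain 1 (23d²ε_h, localised, p29's two-field tower),
chain 2 (B₃δ′_k, global) -/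

section Eq198

variable {gB : B6.Geometry} {X₁ X₂ : Type}
variable {𝔸 : Type} [CStarAlgebra 𝔸] [Nontrivial 𝔸]

/-- **(1.98) p. 200 ON THE LATTICE, BOTH p. 199 `ℍ`-CHAINS FROM [15] (190) WITH THEIR PRINTED SIZES, chain 1 ALL SIZES CONCRETE**
(two-sup reading: print's `α` of the one-sup leaves is `2α′`).  CHAIN 1 — `U″_{k,Z} = (e^{iξℍ₁}C)^{g₁}` over the configuration `C` of
(1.97): the argument field is p29's two-field layer field `B₁ i = log[M^{h−dep i}(U′)(b_i)(M^{h−dep i}(U₀′)(b_i))⁻¹]` (p. 199 *"M˙(U″_{k,Z}) =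
[M˙(U″_{k,Z})(M˙(U₀^{(AL)}))⁻¹]M˙(U₀^{(AL)}). The above field is equal to V″ outside the layer of thickness 2M₁ (in L^{−h}-scale) at
the boundary ∂Ω″^{∼2}_{h+1}. Denote this layer by Σ. … This field can be bounded by … < 23d²ε_h"*; `U′`, `U₀′` free
lattice fields with the located inputs of `B15LayerSupSize.loc_layer199_le`: (1.96) `h96` for `U′`, (1.80)-type `h80` for `U₀′`, (D),
(1.81)–(1.82) `h82`, relative block-axial gauge `h19`), its size `hm` DISCHARGED by `loc_layer199_le`, `hD` ↦ `hfar₁` with the printed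
exponent `δ(M/M₁)(j−h) + ½δMR_h ≤ τD₁` (`hgeom₁`), then `B15HDecayLeaves.boundH199B_of_ineq190` + `B15Bounds199.chainB_le` (flow
`ε_h ≤ (1+β₀)²(1+(j−h)^{β₀})ε_j`, `δ(M/M₁) ≥ 1`, `½δM ≥ 1`) + `chainB_lt` with *"23d²B₃(1+β₀)²e^{−R_h} < α′"* FROM γ
(`B15GammaSmallness.exp_neg_R_le_gamma_sq`, clause `23d²B₃(1+β₀)²γ² < α′`), for BOTH output sizes `supSize gB box blk` and
`covDerivBlockSize gB y₀ S ξ C` (dictionary ↦ membership).  CHAIN 2 — `C = (e^{iξℍ₂}C₀)^{g₂}` over `C₀ = U₀^{ū₀}`: argument field a free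
`B′ : X₂ → 𝔸` with the restriction (1.82) `‖B′ i‖ ≤ δ′_k` (⇒ input size `≤ δ′_k`, `loc_le_of_forall`), `B15HDecayLeaves.boundH199C_of_ineq190`
(global) + `B15Bounds199.chainC_le`/`chainC_lt` (`δ′_k ≤ r_kε_k`, `r_k ≤ r_j`, `ε_k ≤ (1+β₀)(1+s)ε_j`, clause `B₃(1+β₀)(1+s)r_j < α′`),
output sizes `supSize`/`covDerivBlockSize gB y₀ S ξ C₀`.  Then (1.80) `h180` for `C₀(∂p)`, `2α′ ≤ 1/8`, `0 ≤ L^{−j} ≤ 1`, `0 < ε_j ≤ 1/10`,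
`ε_kη² ≤ L_{kj}·ε_jξ²`, `L_{kj} ≤ 1`, and the conclusion of `B15Ineq196Proof.ineq198` with `α = 2α′` (the *"increased O(1)"* explicit).
Mean-value dominations `hmv…` as in §§1–8 (discharge: §9 pattern).
[cite: Balaban1989LargeFieldI, (1.97)–(1.98) pp.199–200, (1.80) p.195, (1.82) p.196; Balaban1985Variational, (190) p.308] -/
theorem ineq198_twoSup_of_ineq190_layer199
    -- input index sets / sizes of the two chains, output sizes
    (boxB₁ : gB.Site → Finset X₁) (blkB₁ : X₁ → gB.Site) (dep : X₁ → ℕ) (pt : X₁ → B7Prop1Explicit.Site d) (dir : X₁ → Fin d)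
    (boxB₂ : gB.Site → Finset X₂) (blkB₂ : X₂ → gB.Site)
    (box : gB.Site → Finset (B7Prop1Explicit.Site d)) (blk : B7Prop1Explicit.Site d → gB.Site)
    (y₀ : gB.Site) (S : gB.Site → Finset (B7Prop1Explicit.Site d × Fin d × Fin d))
    {T₁ T₂ : Type*} {dH₁ : T₁ → (X₁ → 𝔸) →ₗ[ℝ] (B7Prop1Explicit.Site d → Fin d → 𝔸)}
    {dH₂ : T₂ → (X₂ → 𝔸) →ₗ[ℝ] (B7Prop1Explicit.Site d → Fin d → 𝔸)}
    {C δ₀ σ τ c D₁ B₃ δ M M₁ εh εj εk δ'k γ gh β₀ α' rk rj s : ℝ} {r R : ℕ}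
    {ξ : ℝ} {L : ℕ} {h k j : ℕ} {Cc C₀ : B7Prop1Explicit.Site d → Fin d → 𝔸ˣ}
    -- (190) for chain 1 (background `C`) and chain 2 (background `C₀`), both output sizes
    (h190₁₀ : ∀ t, Ineq190 (supSize (X := X₁) (E := 𝔸) gB boxB₁ blkB₁)
      (supSize (X := B7Prop1Explicit.Site d) (E := Fin d → 𝔸) gB box blk) (dH₁ t) C δ₀)
    (h190₁₁ : ∀ t, Ineq190 (supSize (X := X₁) (E := 𝔸) gB boxB₁ blkB₁) (covDerivBlockSize gB y₀ S ξ Cc) (dH₁ t) C δ₀)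
    (h190₂₀ : ∀ t, Ineq190 (supSize (X := X₂) (E := 𝔸) gB boxB₂ blkB₂)
      (supSize (X := B7Prop1Explicit.Site d) (E := Fin d → 𝔸) gB box blk) (dH₂ t) C δ₀)
    (h190₂₁ : ∀ t, Ineq190 (supSize (X := X₂) (E := 𝔸) gB boxB₂ blkB₂) (covDerivBlockSize gB y₀ S ξ C₀) (dH₂ t) C δ₀)
    (hC : 0 ≤ C) (hdist : ∀ a b : gB.Site, 0 ≤ gB.dist a b) (hrow : RowSum gB σ c) (hσ : σ ≤ δ₀ / 8) (hτ : 0 ≤ τ)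
    (hστ : σ + τ ≤ δ₀ / 8) (y : gB.Site)
    -- chain 1's argument field: p29's two-field tower of the layer Σ (`loc_layer199_le`), `h` levels, fine fields `U′`, `U₀′`
    (hL : 2 ≤ L) (hd1 : 1 ≤ d) {G : Subgroup 𝔸ˣ} (hG : AvgClosed d L G) (hhk : h ≤ k)
    (U₀' U' : B7Prop1Explicit.Site d → Fin d → 𝔸ˣ) (hU₀' : ∀ x κ, U₀' x κ ∈ G) (hU' : ∀ x κ, U' x κ ∈ G)
    {Cw Xc rr : ℝ} (hε : 0 < εh) (hCw : 0 ≤ Cw) (hδ0 : 0 ≤ δ'k) (lo hi : B7Prop1Explicit.Site d) (hlohi : lo ≤ hi)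
    (h96 : pdevOn (tlo L lo h) (thi L hi h) U' < 3 / 4 * εh * (((L : ℝ) ^ h)⁻¹) ^ 2)
    (h80 : pdevOn (tlo L lo h) (thi L hi h) U₀' < Cw * εk * (((L : ℝ) ^ k)⁻¹) ^ 2)
    (hD : εk ≤ (1 + β₀) * Real.sqrt (k - h : ℕ) * εh)
    (hXc : Xc = (((L : ℝ) ^ (k - h)) ^ 2)⁻¹ * Real.sqrt (k - h : ℕ) * Cw * (1 + β₀)) (hX1 : Xc ≤ 1)
    (hδr : δ'k ≤ (1 + β₀) * Real.sqrt (k - h : ℕ) * rr * εh)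
    (hsmall : 2 * (1 + β₀) * Real.sqrt (k - h : ℕ) * rr < (d : ℝ) ^ 2)
    (hs3 : C0 d * εh ≤ 1 / 3) (hs2 : 2 * εh ≤ c2' d L) (hs6 : 11 * (d : ℝ) ^ 2 * εh + δ'k ≤ 1 / 6)
    (h19 : ∀ n, n < h → ∀ z, tlo L lo n ≤ z → z ≤ thi L hi n → ∀ r : Fin d → Fin L,
      axialFn (avgIter L U' (h - (n + 1))) ((L : ℤ) • z) ((L : ℤ) • z + boxVec L r) =
        axialFn (avgIter L U₀' (h - (n + 1))) ((L : ℤ) • z) ((L : ℤ) • z + boxVec L r))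
    (h82 : ∀ x ν, lo ≤ x → x + e ν ≤ hi →
      ‖((avgIter L U' h x ν * (avgIter L U₀' h x ν)⁻¹ : 𝔸ˣ) : 𝔸) - 1‖ ≤ δ'k)
    (hX : ∀ i, dep i ≤ h ∧ tlo L lo (dep i) ≤ pt i ∧ pt i + e (dir i) ≤ thi L hi (dep i))
    (hfar₁ : ∀ y' i, i ∈ boxB₁ y' → D₁ ≤ gB.dist y y')
    -- chain 2's argument field: `B′` under (1.82)
    (B' : X₂ → 𝔸) (hB' : ∀ i, ‖B' i‖ ≤ δ'k)
    -- the lattice data of p. 199–200: `U″_{k,Z} = (e^{iξℍ₁}C)^{g₁}`, `C = (e^{iξℍ₂}C₀)^{g₂}`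
    (hξ : 0 < ξ) (hCc : ∀ z κ, Cc z κ ∈ U1 𝔸)
    {H₁ : B7Prop1Explicit.Site d → Fin d → 𝔸} (hH₁sa : ∀ z κ, IsSelfAdjoint (H₁ z κ))
    {g₁ : B7Prop1Explicit.Site d → 𝔸ˣ} (hg₁ : ∀ z, g₁ z ∈ U1 𝔸)
    (hC₀ : ∀ z κ, C₀ z κ ∈ U1 𝔸)
    {H₂ : B7Prop1Explicit.Site d → Fin d → 𝔸} (hH₂sa : ∀ z κ, IsSelfAdjoint (H₂ z κ))
    {g₂ : B7Prop1Explicit.Site d → 𝔸ˣ} (hg₂ : ∀ z, g₂ z ∈ U1 𝔸)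
    (hrep : Cc = gaugeAct g₂ (B8Lemma1NonAbelian.mulCfg (B8Eq146AExpansion.expCfg (B8Eq146AExpansion.iEta ξ H₂)) C₀))
    (μ ν : Fin d) (x : B7Prop1Explicit.Site d) {Linv η B₅ dist Cst Lkj : ℝ}
    -- mean-value dominations (chain 1 w.r.t. `B₁`, chain 2 w.r.t. `B′`)
    (hmv₁₀ : ∀ s' : ℝ, (∀ t, (supSize (X := B7Prop1Explicit.Site d) (E := Fin d → 𝔸) gB box blk).loc y (dH₁ t
        (fun i => mlog (((avgIter L U' (h - dep i) (pt i) (dir i) *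
          (avgIter L U₀' (h - dep i) (pt i) (dir i))⁻¹ : 𝔸ˣ) : 𝔸)))) ≤ s') →
      (supSize (X := B7Prop1Explicit.Site d) (E := Fin d → 𝔸) gB box blk).loc y H₁ ≤ s')
    (hmv₁₁ : ∀ s' : ℝ, (∀ t, (covDerivBlockSize gB y₀ S ξ Cc).loc y (dH₁ t
        (fun i => mlog (((avgIter L U' (h - dep i) (pt i) (dir i) *
          (avgIter L U₀' (h - dep i) (pt i) (dir i))⁻¹ : 𝔸ˣ) : 𝔸)))) ≤ s') →
      (covDerivBlockSize gB y₀ S ξ Cc).loc y H₁ ≤ s')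
    (hmv₂₀ : ∀ s' : ℝ, (∀ t, (supSize (X := B7Prop1Explicit.Site d) (E := Fin d → 𝔸) gB box blk).loc y (dH₂ t B') ≤ s') →
      (supSize (X := B7Prop1Explicit.Site d) (E := Fin d → 𝔸) gB box blk).loc y H₂ ≤ s')
    (hmv₂₁ : ∀ s' : ℝ, (∀ t, (covDerivBlockSize gB y₀ S ξ C₀).loc y (dH₂ t B') ≤ s') →
      (covDerivBlockSize gB y₀ S ξ C₀).loc y H₂ ≤ s')
    -- chain 1: the printed localisation exponent and the (B) chain letters
    (hgeom₁ : δ * (M / M₁) * ((j - h : ℕ) : ℝ) + δ * M / 2 * (R : ℝ) ≤ τ * D₁) (hCB : C * c ≤ B₃) (hB₃ : 0 < B₃)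
    (hδM : 1 ≤ δ * (M / M₁)) (hδM2 : 1 ≤ δ * M / 2) (hεj : 0 < εj)
    (hflowB : εh ≤ (1 + β₀) ^ 2 * (1 + ((j - h : ℕ) : ℝ) ^ β₀) * εj) (hβ₀ : 0 < β₀) (hβ₁ : β₀ ≤ 1)
    -- γ data: (2.5) for `R_h`, `0 < g_h ≤ γ`, `log γ⁻² ≥ 1`, the two α′-clauses
    (hr : 1 ≤ r) (hR : B14.IsRj L r gh R) (hgh : 0 < gh) (hgγ : gh ≤ γ) (hγe : 1 ≤ Real.log (γ ^ 2)⁻¹)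
    (hγB : 23 * (d : ℝ) ^ 2 * B₃ * (1 + β₀) ^ 2 * γ ^ 2 < α')
    -- chain 2: the (C) chain letters
    (hεk : 0 ≤ εk) (hrj : 0 ≤ rj) (hs0 : 0 ≤ s) (hδ'k : δ'k ≤ rk * εk) (hrk : rk ≤ rj)
    (hflowC : εk ≤ (1 + β₀) * (1 + s) * εj) (hγC : B₃ * (1 + β₀) * (1 + s) * rj < α')
    -- the output dictionaries, now set geometry (shared by both chains)
    (hx : x ∈ box y) (hxμ : x + e μ ∈ box y) (hxν : x + e ν ∈ box y)
    (hS₁ : (x, μ, ν) ∈ S y) (hS₂ : (x, ν, μ) ∈ S y)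
    -- the located inputs of `ineq198_lattice`: (1.80) for `C₀(∂p)`, α ≤ 1/8, signs, the scale inequality
    (h180 : B15.Ineq180 ‖B8Ineq132.plaqF C₀ μ ν x - 1‖ εk η B₃ B₅ M δ dist Cst)
    (hα' : 2 * α' ≤ 1 / 8) (hL0 : 0 ≤ Linv) (hL1 : Linv ≤ 1) (hε1 : εj ≤ 1 / 10)
    (hXst : 0 ≤ Cst * B₃ * B₅ * M ^ 5 * Real.exp (-δ * dist)) (he : 0 ≤ εk * η ^ 2)
    (hscale : εk * η ^ 2 ≤ Lkj * (εj * ξ ^ 2)) (hLkj1 : Lkj ≤ 1) :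
    ‖B8Ineq132.plaqF (gaugeAct g₁ (B8Lemma1NonAbelian.mulCfg (B8Eq146AExpansion.expCfg
        (B8Eq146AExpansion.iEta ξ H₁)) Cc)) μ ν x - 1‖
      < (2 * Lkj + 4 * (2 * α') + Cst * (1 + Linv * (2 * α') * εj) ^ 2 * B₃ * B₅ * M ^ 5 * Real.exp (-δ * dist) * Lkj)
        * (εj * ξ ^ 2) := by
  have hκ₁ : C * (supSize (X := X₁) (E := 𝔸) gB boxB₁ blkB₁).κ * c ≤ B₃ := by rw [supSize_κ, mul_one]; exact hCB
  have hκ₂ : C * (supSize (X := X₂) (E := 𝔸) gB boxB₂ blkB₂).κ * c ≤ B₃ := by rw [supSize_κ, mul_one]; exact hCB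
  -- chain 1: input size 23d²ε_h (p29), localisation as geometry, (190) ⇒ the printed ℍ-bound, then the (B) chain < α′ε_j
  have hm₁ := loc_layer199_le (box := boxB₁) (blk := blkB₁) dep pt dir L hL hd1 hG hhk U₀' U' hU₀' hU' hε hCw hδ0 lo hi hlohi
    h96 h80 hD hXc hX1 hδr hsmall hs3 hs2 hs6 h19 h82 hX
  have hD₁ : ∀ y', (supSize (X := X₁) (E := 𝔸) gB boxB₁ blkB₁).loc y'
      (fun i => mlog (((avgIter L U' (h - dep i) (pt i) (dir i) *
        (avgIter L U₀' (h - dep i) (pt i) (dir i))⁻¹ : 𝔸ˣ) : 𝔸))) ≠ 0 → D₁ ≤ gB.dist y y' :=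
    fun y' hne => by obtain ⟨i, hi, -⟩ := exists_ne_zero_of_loc_ne_zero hne; exact hfar₁ y' i hi
  have hb₁₀ := B15HDecayLeaves.boundH199B_of_ineq190 h190₁₀ hC hdist hrow hτ hστ _ y hm₁ hD₁ hmv₁₀ hgeom₁ hκ₁ hB₃.le hε.le
  have hb₁₁ := B15HDecayLeaves.boundH199B_of_ineq190 h190₁₁ hC hdist hrow hτ hστ _ y hm₁ hD₁ hmv₁₁ hgeom₁ hκ₁ hB₃.le hε.le
  have hRh : (0 : ℝ) ≤ (R : ℝ) := Nat.cast_nonneg R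
  have hlarge : 23 * (d : ℝ) ^ 2 * B₃ * (1 + β₀) ^ 2 * Real.exp (-(R : ℝ)) < α' := by
    have h1 := B15GammaSmallness.exp_neg_R_le_gamma_sq hr hR hgh hgγ hγe
    have h2 := mul_le_mul_of_nonneg_left h1 (show 0 ≤ 23 * (d : ℝ) ^ 2 * B₃ * (1 + β₀) ^ 2 by positivity)
    exact h2.trans_lt hγB
  have hs₁₀ : (supSize (X := B7Prop1Explicit.Site d) (E := Fin d → 𝔸) gB box blk).loc y H₁ < α' * εj :=
    (hb₁₀.trans (B15Bounds199.chainB_le (j - h) hB₃.le hδM hδM2 hRh hε.le hεj.le hflowB)).trans_lt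
      (B15Bounds199.chainB_lt (j - h) hB₃.le hβ₀ hβ₁ hεj hlarge)
  have hs₁₁ : (covDerivBlockSize gB y₀ S ξ Cc).loc y H₁ < α' * εj :=
    (hb₁₁.trans (B15Bounds199.chainB_le (j - h) hB₃.le hδM hδM2 hRh hε.le hεj.le hflowB)).trans_lt
      (B15Bounds199.chainB_lt (j - h) hB₃.le hβ₀ hβ₁ hεj hlarge)
  -- chain 2: input size δ′_k from (1.82), (190) globally ⇒ B₃δ′_k, then the (C) chain < α′ε_j
  have hm₂ : ∀ y', (supSize (X := X₂) (E := 𝔸) gB boxB₂ blkB₂).loc y' B' ≤ δ'k :=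
    fun y' => loc_le_of_forall hδ0 fun i _ => hB' i
  have hb₂₀ := B15HDecayLeaves.boundH199C_of_ineq190 h190₂₀ hC hdist hrow hσ B' y hm₂ hmv₂₀ hκ₂
  have hb₂₁ := B15HDecayLeaves.boundH199C_of_ineq190 h190₂₁ hC hdist hrow hσ B' y hm₂ hmv₂₁ hκ₂
  have hs₂₀ : (supSize (X := B7Prop1Explicit.Site d) (E := Fin d → 𝔸) gB box blk).loc y H₂ < α' * εj :=
    (hb₂₀.trans (B15Bounds199.chainC_le hB₃.le hεk hrj hδ'k hrk hflowC)).trans_lt (B15Bounds199.chainC_lt hγC hεj)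
  have hs₂₁ : (covDerivBlockSize gB y₀ S ξ C₀).loc y H₂ < α' * εj :=
    (hb₂₁.trans (B15Bounds199.chainC_le hB₃.le hεk hrj hδ'k hrk hflowC)).trans_lt (B15Bounds199.chainC_lt hγC hεj)
  -- the two (1.91)-shaped steps of p. 199 (two-sup reading), then the (1.98) arithmetic with α = 2α′
  set Y₁ := max ((supSize (X := B7Prop1Explicit.Site d) (E := Fin d → 𝔸) gB box blk).loc y H₁)
    ((covDerivBlockSize gB y₀ S ξ Cc).loc y H₁) with hY₁
  set Y₂ := max ((supSize (X := B7Prop1Explicit.Site d) (E := Fin d → 𝔸) gB box blk).loc y H₂)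
    ((covDerivBlockSize gB y₀ S ξ C₀).loc y H₂) with hY₂
  have hY₁lt : Y₁ < α' * εj := max_lt hs₁₀ hs₁₁
  have hY₂lt : Y₂ < α' * εj := max_lt hs₂₀ hs₂₁
  have h1 := B15Ineq191Lattice.ineq191_lattice_twoSup hξ hCc hH₁sa hg₁ μ ν x
    ((norm_apply_apply_le_loc hx H₁ μ).trans (le_max_left _ _))
    ((norm_apply_apply_le_loc hxμ H₁ ν).trans (le_max_left _ _))
    ((norm_apply_apply_le_loc hxν H₁ μ).trans (le_max_left _ _))
    ((norm_apply_apply_le_loc hx H₁ ν).trans (le_max_left _ _))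
    ((norm_covDerivFwd_le_loc hS₁ H₁).trans (le_max_right _ _))
    ((norm_covDerivFwd_le_loc hS₂ H₁).trans (le_max_right _ _)) hY₁lt hεj.le hL0
  have h2 := B15Ineq191Lattice.ineq191_lattice_twoSup hξ hC₀ hH₂sa hg₂ μ ν x
    ((norm_apply_apply_le_loc hx H₂ μ).trans (le_max_left _ _))
    ((norm_apply_apply_le_loc hxμ H₂ ν).trans (le_max_left _ _))
    ((norm_apply_apply_le_loc hxν H₂ μ).trans (le_max_left _ _))
    ((norm_apply_apply_le_loc hx H₂ ν).trans (le_max_left _ _))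
    ((norm_covDerivFwd_le_loc hS₁ H₂).trans (le_max_right _ _))
    ((norm_covDerivFwd_le_loc hS₂ H₂).trans (le_max_right _ _)) hY₂lt hεj.le hL0
  rw [← hrep] at h2
  have hα0 : 0 ≤ 2 * α' := by
    have h0 : 0 ≤ B₃ * (1 + β₀) * (1 + s) * rj := by positivity
    linarith [h0.trans_lt hγC]
  exact B15Ineq196Proof.ineq198 h1 h2 h180 hα0 hα' hL0 hL1 hεj.le hε1 (by positivity) hXst he hscale hLkj1

end Eq198

end Literature.MathematicalPhysics.QuantumFieldTheory.Balaban1983to89.B15From190LayerSizes
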